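import Literature.MathematicalPhysics.QuantumFieldTheory.Balaban1983to89.B9Thm314PFlatTransfer
import Literature.MathematicalPhysics.QuantumFieldTheory.Balaban1983to89.B9Thm314QGGQInvFlatMultiLevelTorus
import Literature.MathematicalPhysics.QuantumFieldTheory.Balaban1983to89.B9Thm314GpFlatEntries
import Literature.MathematicalPhysics.QuantumFieldTheory.Balaban1983to89.B9Ineq349MultiLevelTorusP23

/-!
# `Balaban1983to89.B9Thm314PFlatMultiLevelTorus` — [B9] THEOREM 3.14 (pp. 426–427, (3.154)) AT `U = 1` FOR PRINT'S
`P = I − R = G′Q′*(Q′G′²Q′*)⁻¹Q′G′` ON THE GENUINE `k`-LEVEL TORUS, FILE 2 OF 2: for two nested families `{Ω_j}`, `{Ω′_j}`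
on one torus `T_η`, top blocks `y ∋ x`, `y′ ∋ x′` of both families, `Ω = Ω_k ∩ Ω′_k`, ALL FOUR KERNEL MEMBERS of (3.49):
`|P[Ω](x,x′) − P[Ω′](x,x′)|`, `|(∂_μP)[Ω] − (∂_μP)[Ω′]|`, `|(P∂*_ν)[Ω] − (P∂*_ν)[Ω′]|`, `|(∂_μP∂*_ν)[Ω] − (∂_μP∂*_ν)[Ω′]|`
`≤ C·[1, (L^k)⁻¹, (L^k)⁻¹, (L^k)⁻²]·((L^k)^{d+1})⁻¹·e^{−δ·min(d_Ω,d_Ω′)(y,y′)}·e^{−δ·d(y,y′,Ω)}` — the characteristic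
inequality (3.49) «with the additional factor exp(−δ₀d(y, y′, Ω))», `k`-UNIFORM constants, «M and R sufficiently large»
explicit (no existing module is touched; no `def`; no fact is minted)

FRAMING (verbatim cell line):
statement-level skeleton of published theorems with citation tags; proofs where landed; nothing here is a claim about the Yang–Mills mass gap

Sources under audit (cell pub-balaban / lit-balaban): T. Bałaban, *Propagators for lattice gauge theories in a
background field*, Commun. Math. Phys. **99** (1985) 389–434 [`Balaban1985BackgroundPropagators`, "B9"], pp. 426–427
[PDF 38–39] (Theorem 3.14, (3.154)), p. 399 [PDF 11] ((3.49)), p. 394 [PDF 6] ((3.25)) — held text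
`paper:balaban1985-cmp99-background-propagators` p0038/p0039/p0011 read this generation; T. Bałaban, *Propagators and
renormalization transformations for lattice gauge theories. II*, Commun. Math. Phys. **96** (1984) 223–250
[`Balaban1984PropagatorsII`, "[4]"], (2.17) p. 225, Prop. 2.3 (2.87)–(2.88) p. 238, (2.60)–(2.61) p. 234.  Unit
`lit-balaban-p21` (Phase-2 proof seat p21 gen 19, HOME `run/shared/lean/pub/lit-balaban/`, free-target protocol
G.5-34(d); B9 fold owner r06, referee ref-4).

## WHAT IS PRINTED (quotations AS PRINTED)

B9 p. 426–427 (scan p038/p039): «**Theorem 3.14.** If we take a pair of operators constructed for the two sequences {Ω_j},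
{Ω′_j}, then their difference satisfies all the inequalities characteristic for operators of the considered type, with the
additional factor exp(−δ₀d(y, y′, Ω)), d(y, y′, Ω) = inf_{y₁∈Ωᶜ∩T^{(k)}} (|y − y₁| + |y₁ − y′|) (3.154) on the right-hand
sides.»  B9 p. 399 (scan p011): «For the operator P = I − R we obtain, using again Lemma 2.1,
[|P(x,x′)|, |(DP)_μ(x,x′)|, |(PD*)_ν(x,x′)|, |(DPD*)_{μν}(x,x′)|] ≦ O(1)[1, (L^jη)⁻¹, (L^{j′}η)⁻¹, (L^jη)⁻¹(L^{j′}η)⁻¹]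
(L^{j′}η)^{−d}e^{−δ₀d(y,y′)} for x ∈ Δ(y), y ∈ Λ_j, x′ ∈ Δ(y′), y′ ∈ Λ_{j′}. (3.49)»; p. 394: «Rf = (I − G′Q′*(Q′G′²Q′*)⁻¹Q′G′)f»
(3.25).

## WHAT THIS FILE CERTIFIES (kernel-checked; lattice units `η = 1`; setting of `B9Thm314GpFlatTorusGeometry`)

* §1 `sum_bound` — file 1's identity `word_sub_word` and term estimates summed by (2.61) at `¼δ`
  (`|w[D] − w[D′]| ≤ K_tot·L^{n_Lk}L^{n_Rk}L^{−4k}W(y′)⁻¹·e^{−¼δd(y,y′,Ω)}`, `K_tot` explicit); **`p_engine`** — plus the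
  single-family (3.49) bounds of both families (trivial two-term bound) and `min(P²F,Q²F) ≤ PQF`
  (`B9Thm314GpFlatMultiLevelTorus.combined_bound`).
* §2 `leg_of_hasMajorant` (the torus (2.67) majorants read on `λ_s = 1_{B(s)}`), `cinv_of_prop23` (the torus (2.87) as a bound
  of the (2.69)-kernel `CinvT`), `word_m1`–`word_m4` (r05's four members of `pProjMLT D a (GinvT D a)` ARE the words
  `T·Q′*·(Q′G′²Q′*)⁻¹·Q′·S` with `T, S ∈ {G′, ∂G′}`; `G′` symmetric), `scale_eq`, `reshape`.
* §3 **`thm314_P_flat_multiLevelTorus`**: `∃ δ C M₀ N₀ > 0`, for every `k`, `M_h ≥ 3` with `L·M_h ≥ M₀`, `R ≥ 2L` with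
  `R·L·M_h ≥ N₀ + 1`, `P_μ ≥ 4`, every two families `D, D′`, windowed weights, every two blocks at the top level in BOTH
  families and sites `x ∈ B(y)`, `x′ ∈ B(y′)`: the four inequalities above for the differences of r05's
  `B9Ineq349MultiLevelTorus.pProjMLT D a (GinvT D a)` members (`Pi.single x′ 1` rows, `(dT ν)ᵀ` on the right, `dT μ` on the
  left).  Inputs BY NAME: `B8Ineq198MultiLevelTorusP22.prop22_entries1236_multiLevelTorus` (the (2.67) majorants of `G′`,
  `∂_μG′`, both families), `B6Prop23MultiLevelTorus.prop23_multiLevelTorus` ((2.87), both families), gen-18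
  `B9Thm314GpFlatEntries.thm314_Gp_sup_flat_multiLevelTorus` (Theorem 3.14 for `G′`, `∂G′` — the outer letters on common
  blocks), `B9Thm314QGGQInvFlatMultiLevelTorus.thm314_QGGQinv_flat_multiLevelTorus` (Theorem 3.14 for `(Q′G′²Q′*)⁻¹` — the
  middle), r05's `B9Ineq349MultiLevelTorusP23.ineq349_multiLevelTorus_P23` ((3.49) at `U = 1`, both families — the trivial
  bound), `consts_260_261` and file 1's `pow_le_exp_of_threshold` ((2.60)/(2.61) thresholds at powers `2`, `d + 1`).
  Non-vacuity of the hypotheses: `B9Thm314GpFlatMultiLevelTorus.thm314_Gp_flat_nonvacuous` (same binder shape).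

## HONEST SCOPE

* `U = 1` only; torus lineage of this seat (`Ω₁ = T_η`, levels `1 … k`, lattice units, spatial dimension `d + 1`, so print's
  `(L^{j′}η)^{−d}` is `((L^k)^{d+1})⁻¹` here, `j = j′ = k`, `P_μ ≥ 4`); ONLY the operator `P = I − R` of (3.25) among those of
  Theorem 3.14 (`G′`: gen 18; `(Q′G′²Q′*)⁻¹`: `B9Thm314QGGQInvFlat*`; `G`, `G₁`, `𝔊`, `H`, `H₁`, `(QGQ*)⁻¹` are not treated),
  ONLY common top blocks, and the characteristic factor carries `min(d_D, d_{D′})` (two families, two distances (2.46);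
  print writes one `d(y, y′)`).  The Hölder remark after (3.49) is not treated.
* ROUTE (declared; `U = 1` admits it): file 1's transfer telescoping through the common top blocks in place of print's
  walk-expansion cancellation.  Constants: input rate `δ = min(½δ₀, ½δ₁, δ₂, δ₃)` of the four inputs, trivial rate `ρ` of
  r05's (3.49); output rate `¼·min(ρ, ½δ)`; `C = √(2B)·√K_tot + 1` with `K_tot` the explicit polynomial of `sum_bound` in the
  input constants, `L`, `e^{δ}` and the (2.61)-constant; thresholds = maxima of the input thresholds and of the (2.60)
  thresholds at powers `2` and `d + 1` — all `k`-uniform, independent of `D, D′`.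
* Nothing is inferred from the manuscript: every step is kernel-checked; the quoted sentences locate the statements.
-/

namespace Literature.MathematicalPhysics.QuantumFieldTheory.Balaban1983to89.B9Thm314PFlatMultiLevelTorus

open Finset Matrix
open Literature.MathematicalPhysics.QuantumFieldTheory.Balaban1983to89.B4Reflection242 (boxDom blk)
open Literature.MathematicalPhysics.QuantumFieldTheory.Balaban1983to89.B6MultiLevelBoxOperator
open Literature.MathematicalPhysics.QuantumFieldTheory.Balaban1983to89.B6MultiLevelTorusOperator
open Literature.MathematicalPhysics.QuantumFieldTheory.Balaban1983to89.B6Geom246MultiLevelBox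
open Literature.MathematicalPhysics.QuantumFieldTheory.Balaban1983to89.B6Geom246MultiLevelTorus
open Literature.MathematicalPhysics.QuantumFieldTheory.Balaban1983to89.B8Ineq192MultiLevelTorus (geomTB geomTB_dist
  geomTB_L geomTB_RM geomTB_RM_nonneg levelSepTB lenT_eq symmT symmTB XkT W_eq_lenT_pow lenT_pos)
open Literature.MathematicalPhysics.QuantumFieldTheory.Balaban1983to89.B6Lemma21Repaired (Ineq261With)
open Literature.MathematicalPhysics.QuantumFieldTheory.Balaban1983to89.B6RandomWalk (HasMajorant BlockSupp)
open Literature.MathematicalPhysics.QuantumFieldTheory.Balaban1983to89.B6Ineq243TwoLevelBox (aNext)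
open Literature.MathematicalPhysics.QuantumFieldTheory.Balaban1983to89.B6Prop22DerivMultiLevelTorus (dT)
open Literature.MathematicalPhysics.QuantumFieldTheory.Balaban1983to89.B9Thm314GpFlatTorusGeometry
open Literature.MathematicalPhysics.QuantumFieldTheory.Balaban1983to89.B9Thm314GpFlatResolvent (blkOf_eq_iff_blkOf_eq)
open Literature.MathematicalPhysics.QuantumFieldTheory.Balaban1983to89.B9Thm314GpFlatMultiLevelTorus (combined_bound
  consts_260_261 hasMajorant_of_eq)
open Literature.MathematicalPhysics.QuantumFieldTheory.Balaban1983to89.B9Thm314GpFlatEntries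
  (thm314_Gp_sup_flat_multiLevelTorus)
open Literature.MathematicalPhysics.QuantumFieldTheory.Balaban1983to89.B9Thm314GpSqFlatMultiLevelTorus (W_common)
open Literature.MathematicalPhysics.QuantumFieldTheory.Balaban1983to89.B9Thm314QGGQInvFlatTransfer
open Literature.MathematicalPhysics.QuantumFieldTheory.Balaban1983to89.B9Thm314QGGQInvFlatMultiLevelTorus
  (thm314_QGGQinv_flat_multiLevelTorus)
open Literature.MathematicalPhysics.QuantumFieldTheory.Balaban1983to89.B9Thm314PFlatTransfer
open Literature.MathematicalPhysics.QuantumFieldTheory.Balaban1983to89.B6Ineq268MultiLevelBox (W W_pos W_eq QB QsB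
  QsB_apply QB_apply)
open Literature.MathematicalPhysics.QuantumFieldTheory.Balaban1983to89.B6Prop23MultiLevelTorus (GinvT CinvT mat_GinvT_div
  prop23_multiLevelTorus)
open Literature.MathematicalPhysics.QuantumFieldTheory.Balaban1983to89.B6Prop23Chain (mat mat_kerOp apply_eq_sum_mat)
open Literature.MathematicalPhysics.QuantumFieldTheory.Balaban1983to89.B6Expansion282 (kerOp)
open Literature.MathematicalPhysics.QuantumFieldTheory.Balaban1983to89.B6Ineq288MultiLevelTorus (lam)
open Literature.MathematicalPhysics.QuantumFieldTheory.Balaban1983to89.B9Ineq349MultiLevelTorus (pProjMLT pProjMLT_apply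
  col_gmlT_eq_row col_gmlT_transpose_eq_row)
open Literature.MathematicalPhysics.QuantumFieldTheory.Balaban1983to89.B9Ineq349MultiLevelTorusP23
  (ineq349_multiLevelTorus_P23)
open Literature.MathematicalPhysics.QuantumFieldTheory.Balaban1983to89.B8Ineq198MultiLevelTorusP22
  (prop22_entries1236_multiLevelTorus)

noncomputable section

variable {d : ℕ}

/-! ## §1 The three sums by (2.61); the total; the engine (trivial bound + `combined_bound`) -/

section Sum

variable {ℓ Mh k R : ℕ} {P : Fin (d + 1) → ℕ} (D D' : TDomains d ℓ Mh k P R) (a : ℕ → ℝ)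

/-- **THE SUM OF THE THREE TERMS**: under the hypotheses of file 1's `termA_le`, `termB_le`, `termC_le` and (2.61) at `¼δ`
on both block lattices (constant `c`), for common top blocks `y ∋ x`, `y′ ∋ x′`:
`|w[D](x,x′) − w[D′](x,x′)| ≤ K_tot·L^{n_Lk}L^{n_Rk}L^{−4k}W(y′)⁻¹·e^{−¼δd(y,y′,Ω)}`,
`K_tot = (K_A + K_C)·c + K_B·c²` (file 1's identity `word_sub_word`, the three term estimates, (2.61) once or twice).
[cite: Balaban1985BackgroundPropagators, Thm 3.14 (3.154) pp.426–427, (3.49) p.399; Balaban1984PropagatorsII, (2.61) p.234] -/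
theorem sum_bound (hMh : 1 ≤ Mh) (hP : ∀ μ, 1 ≤ P μ) (hRM : 1 ≤ R * ((ℓ + 1) * Mh))
    {TL TL' : Module.End ℝ (↥(boxDom (N0 ℓ Mh k P)) → ℝ)}
    {S S' : Matrix ↥(boxDom (N0 ℓ Mh k P)) ↥(boxDom (N0 ℓ Mh k P)) ℝ} {x x' : ↥(boxDom (N0 ℓ Mh k P))}
    {CE CG CΔ δ c : ℝ} {nL nR : ℕ} (hCE : 0 ≤ CE) (hCG : 0 ≤ CG) (hCΔ : 0 ≤ CΔ) (hδ : 0 ≤ δ)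
    {y y' : ↥(bset D.toDomains)} (hy : y.1.1 = k ∧ y.1 ∈ bset D'.toDomains)
    (hy' : y'.1.1 = k ∧ y'.1 ∈ bset D'.toDomains)
    (hE : ∀ s : ↥(bset D.toDomains), |TL (lam D s) x|
      ≤ CE * ((ℓ : ℝ) + 1) ^ (nL * k) * Real.exp (-(δ * (geomT D).dist y s)))
    (hE' : ∀ s' : ↥(bset D'.toDomains), |TL' (lam D' s') x|
      ≤ CE * ((ℓ : ℝ) + 1) ^ (nL * k) * Real.exp (-(δ * (geomT D').dist ⟨y.1, hy.2⟩ s')))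
    (hF : ∀ s : ↥(bset D.toDomains), |(S *ᵥ lam D s) x'|
      ≤ CE * ((ℓ : ℝ) + 1) ^ (nR * k) * Real.exp (-(δ * (geomT D).dist y' s)))
    (hF' : ∀ s' : ↥(bset D'.toDomains), |(S' *ᵥ lam D' s') x'|
      ≤ CE * ((ℓ : ℝ) + 1) ^ (nR * k) * Real.exp (-(δ * (geomT D').dist ⟨y'.1, hy'.2⟩ s')))
    (hC : ∀ u v : ↥(bset D.toDomains), |CinvT D a u v|
      ≤ CG * (((ℓ : ℝ) + 1) ^ (4 * u.1.1))⁻¹ * (W D.toDomains v)⁻¹ * Real.exp (-(δ * (geomT D).dist u v)))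
    (hC' : ∀ u' v' : ↥(bset D'.toDomains), |CinvT D' a u' v'|
      ≤ CG * (((ℓ : ℝ) + 1) ^ (4 * u'.1.1))⁻¹ * (W D'.toDomains v')⁻¹ * Real.exp (-(δ * (geomT D').dist u' v')))
    (hΔE : ∀ u : ↥(bset D.toDomains), u.1.1 = k ∧ u.1 ∈ bset D'.toDomains →
      |TL (lam D u) x - TL' (lam D u) x| ≤ CΔ * ((ℓ : ℝ) + 1) ^ (nL * k) * Real.exp (-(δ * dOmega D D' y.1.2 u.1.2)))
    (hΔF : ∀ u' : ↥(bset D'.toDomains), u'.1.1 = k ∧ u'.1 ∈ bset D.toDomains →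
      |(S *ᵥ lam D' u') x' - (S' *ᵥ lam D' u') x'|
        ≤ CΔ * ((ℓ : ℝ) + 1) ^ (nR * k) * Real.exp (-(δ * dOmega D D' y'.1.2 u'.1.2)))
    (hΔC : ∀ (u' : ↥(bset D'.toDomains)) (v : ↥(bset D.toDomains)) (hu' : u'.1.1 = k ∧ u'.1 ∈ bset D.toDomains)
      (hv : v.1.1 = k ∧ v.1 ∈ bset D'.toDomains),
      |CinvT D a ⟨u'.1, hu'.2⟩ v - CinvT D' a u' ⟨v.1, hv.2⟩|
        ≤ CΔ * (((ℓ : ℝ) + 1) ^ (4 * k))⁻¹ * ((((ℓ : ℝ) + 1) ^ k) ^ (d + 1))⁻¹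
          * Real.exp (-(δ * dOmega D D' u'.1.2 v.1.2)))
    (hthr2 : ((ℓ : ℝ) + 1) ^ 2 ≤ Real.exp (1 / 4 * (δ / 2) * ((R : ℝ) * (((ℓ : ℝ) + 1) * Mh) - 1)))
    (hthrW : ((ℓ : ℝ) + 1) ^ (d + 1) ≤ Real.exp (δ / 4 * ((R : ℝ) * (((ℓ : ℝ) + 1) * Mh) - 1)))
    (h261 : Ineq261With c (geomT D) δ (1 / 4)) (h261' : Ineq261With c (geomT D') δ (1 / 4)) :
    |TL (QsB D.toDomains (GinvT D a (QB D.toDomains (fun w => S x' w)))) x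
        - TL' (QsB D'.toDomains (GinvT D' a (QB D'.toDomains (fun w => S' x' w)))) x|
      ≤ (((CΔ + CE * ((ℓ : ℝ) + 1) ^ 4 * Real.exp (δ / 2)) * (CG * CE * c * ((ℓ : ℝ) + 1) ^ (d + 1))
            + (CE * CG * c * ((ℓ : ℝ) + 1) ^ 4) * (CΔ + CE * ((ℓ : ℝ) + 1) ^ (d + 1) * Real.exp (δ / 2))) * c
          + CE ^ 2 * (CΔ + CG * ((ℓ : ℝ) + 1) ^ (d + 1) + CG * ((ℓ : ℝ) + 1) ^ 4) * Real.exp δ * c ^ 2)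
        * (((ℓ : ℝ) + 1) ^ (nL * k) * ((ℓ : ℝ) + 1) ^ (nR * k) * (((ℓ : ℝ) + 1) ^ (4 * k))⁻¹ * (W D.toDomains y')⁻¹)
        * Real.exp (-(δ / 4 * dOmega D D' y.1.2 y'.1.2)) := by
  have hc0 : 0 ≤ c := c261_nonneg D h261 y
  have hWy : 0 < (W D.toDomains y')⁻¹ := inv_pos.2 (W_pos D.toDomains y')
  -- non-negativity of the common factors, before abbreviating them
  have hΛ0' : 0 ≤ ((ℓ : ℝ) + 1) ^ (nL * k) * ((ℓ : ℝ) + 1) ^ (nR * k)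
      * (((ℓ : ℝ) + 1) ^ (4 * k))⁻¹ * (W D.toDomains y')⁻¹ := by positivity
  have hKA0' : 0 ≤ (CΔ + CE * ((ℓ : ℝ) + 1) ^ 4 * Real.exp (δ / 2))
      * (CG * CE * c * ((ℓ : ℝ) + 1) ^ (d + 1)) := by positivity
  have hKB0' : 0 ≤ CE ^ 2 * (CΔ + CG * ((ℓ : ℝ) + 1) ^ (d + 1) + CG * ((ℓ : ℝ) + 1) ^ 4) * Real.exp δ := by
    positivity
  have hKC0' : 0 ≤ (CE * CG * c * ((ℓ : ℝ) + 1) ^ 4)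
      * (CΔ + CE * ((ℓ : ℝ) + 1) ^ (d + 1) * Real.exp (δ / 2)) := by positivity
  have heΩ2' : Real.exp (-(δ / 2 * dOmega D D' y.1.2 y'.1.2)) ≤ Real.exp (-(δ / 4 * dOmega D D' y.1.2 y'.1.2)) :=
    Real.exp_le_exp.2 (by nlinarith [dOmega_nonneg D D' y.1.2 y'.1.2])
  -- abbreviations of the common factors (real numbers, not functions)
  obtain ⟨Λ, hΛ⟩ : ∃ Λ : ℝ, Λ = ((ℓ : ℝ) + 1) ^ (nL * k) * ((ℓ : ℝ) + 1) ^ (nR * k)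
      * (((ℓ : ℝ) + 1) ^ (4 * k))⁻¹ * (W D.toDomains y')⁻¹ := ⟨_, rfl⟩
  obtain ⟨KA, hKA⟩ : ∃ KA : ℝ, KA = (CΔ + CE * ((ℓ : ℝ) + 1) ^ 4 * Real.exp (δ / 2))
      * (CG * CE * c * ((ℓ : ℝ) + 1) ^ (d + 1)) := ⟨_, rfl⟩
  obtain ⟨KB, hKB⟩ : ∃ KB : ℝ, KB = CE ^ 2 * (CΔ + CG * ((ℓ : ℝ) + 1) ^ (d + 1) + CG * ((ℓ : ℝ) + 1) ^ 4)
      * Real.exp δ := ⟨_, rfl⟩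
  obtain ⟨KC, hKC⟩ : ∃ KC : ℝ, KC = (CE * CG * c * ((ℓ : ℝ) + 1) ^ 4)
      * (CΔ + CE * ((ℓ : ℝ) + 1) ^ (d + 1) * Real.exp (δ / 2)) := ⟨_, rfl⟩
  obtain ⟨eΩ, heΩ⟩ : ∃ eΩ : ℝ, eΩ = Real.exp (-(δ / 4 * dOmega D D' y.1.2 y'.1.2)) := ⟨_, rfl⟩
  have hΛ0 : 0 ≤ Λ := by rw [hΛ]; exact hΛ0'
  have hKA0 : 0 ≤ KA := by rw [hKA]; exact hKA0'
  have hKB0 : 0 ≤ KB := by rw [hKB]; exact hKB0'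
  have hKC0 : 0 ≤ KC := by rw [hKC]; exact hKC0'
  have heΩ0 : 0 ≤ eΩ := by rw [heΩ]; exact (Real.exp_pos _).le
  have heΩ2 : Real.exp (-(δ / 2 * dOmega D D' y.1.2 y'.1.2)) ≤ eΩ := by rw [heΩ]; exact heΩ2'
  -- term A summed
  have hA : |∑ u : ↥(bset D.toDomains),
      (TL (lam D u) x - (if u.1.1 = k ∧ u.1 ∈ bset D'.toDomains then TL' (lam D u) x else 0))
        * ∑ v : ↥(bset D.toDomains), CinvT D a u v * (S *ᵥ lam D v) x'| ≤ KA * c * Λ * eΩ := by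
    refine (Finset.abs_sum_le_sum_abs _ _).trans ?_
    calc ∑ u : ↥(bset D.toDomains), |(TL (lam D u) x
            - (if u.1.1 = k ∧ u.1 ∈ bset D'.toDomains then TL' (lam D u) x else 0))
            * ∑ v : ↥(bset D.toDomains), CinvT D a u v * (S *ᵥ lam D v) x'|
        ≤ ∑ u : ↥(bset D.toDomains), KA * Λ * eΩ * Real.exp (-(δ / 4 * (geomT D).dist u y')) := by
          refine Finset.sum_le_sum fun u _ => ?_
          rw [abs_mul]
          have h := termA_le D D' a hMh hP hRM hCE hCG hCΔ hδ hy hy' hE hF hC hΔE hthr2 hthrW h261 u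
          rw [← hΛ, ← hKA, ← heΩ] at h
          exact h
      _ = KA * Λ * eΩ * ∑ u : ↥(bset D.toDomains), Real.exp (-(δ / 4 * (geomT D).dist u y')) := by
          rw [Finset.mul_sum]
      _ ≤ KA * Λ * eΩ * c :=
          mul_le_mul_of_nonneg_left (sum_exp_le' D h261 y') (mul_nonneg (mul_nonneg hKA0 hΛ0) heΩ0)
      _ = KA * c * Λ * eΩ := by ring
  -- term B summed (twice (2.61))
  have hB : |∑ u' : ↥(bset D'.toDomains), TL' (lam D' u') x *
      ∑ v : ↥(bset D.toDomains),
        ((if h : u'.1.1 = k ∧ u'.1 ∈ bset D.toDomains then CinvT D a ⟨u'.1, h.2⟩ v else 0)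
          - (if h : v.1.1 = k ∧ v.1 ∈ bset D'.toDomains then CinvT D' a u' ⟨v.1, h.2⟩ else 0))
        * (S *ᵥ lam D v) x'| ≤ KB * c ^ 2 * Λ * eΩ := by
    refine (Finset.abs_sum_le_sum_abs _ _).trans ?_
    have inner : ∀ u' : ↥(bset D'.toDomains), |TL' (lam D' u') x *
        ∑ v : ↥(bset D.toDomains),
          ((if h : u'.1.1 = k ∧ u'.1 ∈ bset D.toDomains then CinvT D a ⟨u'.1, h.2⟩ v else 0)
            - (if h : v.1.1 = k ∧ v.1 ∈ bset D'.toDomains then CinvT D' a u' ⟨v.1, h.2⟩ else 0))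
          * (S *ᵥ lam D v) x'|
        ≤ KB * Λ * eΩ * Real.exp (-(δ / 4 * (geomT D').dist ⟨y.1, hy.2⟩ u')) * c := by
      intro u'
      rw [abs_mul]
      calc |TL' (lam D' u') x| * |∑ v : ↥(bset D.toDomains),
            ((if h : u'.1.1 = k ∧ u'.1 ∈ bset D.toDomains then CinvT D a ⟨u'.1, h.2⟩ v else 0)
              - (if h : v.1.1 = k ∧ v.1 ∈ bset D'.toDomains then CinvT D' a u' ⟨v.1, h.2⟩ else 0))
            * (S *ᵥ lam D v) x'|
          ≤ |TL' (lam D' u') x| * ∑ v : ↥(bset D.toDomains),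
              |((if h : u'.1.1 = k ∧ u'.1 ∈ bset D.toDomains then CinvT D a ⟨u'.1, h.2⟩ v else 0)
                - (if h : v.1.1 = k ∧ v.1 ∈ bset D'.toDomains then CinvT D' a u' ⟨v.1, h.2⟩ else 0))
              * (S *ᵥ lam D v) x'| :=
            mul_le_mul_of_nonneg_left (Finset.abs_sum_le_sum_abs _ _) (abs_nonneg _)
        _ = ∑ v : ↥(bset D.toDomains), |TL' (lam D' u') x|
              * |(if h : u'.1.1 = k ∧ u'.1 ∈ bset D.toDomains then CinvT D a ⟨u'.1, h.2⟩ v else 0)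
                - (if h : v.1.1 = k ∧ v.1 ∈ bset D'.toDomains then CinvT D' a u' ⟨v.1, h.2⟩ else 0)|
              * |(S *ᵥ lam D v) x'| := by
            rw [Finset.mul_sum]
            exact Finset.sum_congr rfl fun v _ => by rw [abs_mul, mul_assoc]
        _ ≤ ∑ v : ↥(bset D.toDomains), KB * Λ * Real.exp (-(δ / 2 * dOmega D D' y.1.2 y'.1.2))
              * (Real.exp (-(δ / 4 * (geomT D').dist ⟨y.1, hy.2⟩ u'))
                * Real.exp (-(δ / 4 * (geomT D).dist y' v))) := by
            refine Finset.sum_le_sum fun v _ => ?_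
            have h := termB_le D D' a hMh hP hRM hCE hCG hCΔ hδ hy hy' hE' hF hC hC' hΔC hthr2 hthrW u' v
            rw [← hΛ, ← hKB] at h
            exact h
        _ = KB * Λ * Real.exp (-(δ / 2 * dOmega D D' y.1.2 y'.1.2))
              * Real.exp (-(δ / 4 * (geomT D').dist ⟨y.1, hy.2⟩ u'))
              * ∑ v : ↥(bset D.toDomains), Real.exp (-(δ / 4 * (geomT D).dist y' v)) := by
            rw [Finset.mul_sum]
            exact Finset.sum_congr rfl fun v _ => by ring
        _ ≤ KB * Λ * Real.exp (-(δ / 2 * dOmega D D' y.1.2 y'.1.2))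
              * Real.exp (-(δ / 4 * (geomT D').dist ⟨y.1, hy.2⟩ u')) * c :=
            mul_le_mul_of_nonneg_left (sum_exp_le D h261 y')
              (mul_nonneg (mul_nonneg (mul_nonneg hKB0 hΛ0) (Real.exp_pos _).le) (Real.exp_pos _).le)
        _ ≤ KB * Λ * eΩ * Real.exp (-(δ / 4 * (geomT D').dist ⟨y.1, hy.2⟩ u')) * c := by
            have := mul_le_mul_of_nonneg_left heΩ2 (mul_nonneg hKB0 hΛ0)
            exact mul_le_mul_of_nonneg_right (mul_le_mul_of_nonneg_right this (Real.exp_pos _).le) hc0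
    calc ∑ u' : ↥(bset D'.toDomains), |TL' (lam D' u') x *
          ∑ v : ↥(bset D.toDomains),
            ((if h : u'.1.1 = k ∧ u'.1 ∈ bset D.toDomains then CinvT D a ⟨u'.1, h.2⟩ v else 0)
              - (if h : v.1.1 = k ∧ v.1 ∈ bset D'.toDomains then CinvT D' a u' ⟨v.1, h.2⟩ else 0))
            * (S *ᵥ lam D v) x'|
        ≤ ∑ u' : ↥(bset D'.toDomains), KB * Λ * eΩ * Real.exp (-(δ / 4 * (geomT D').dist ⟨y.1, hy.2⟩ u')) * c :=
          Finset.sum_le_sum fun u' _ => inner u'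
      _ = KB * Λ * eΩ * c * ∑ u' : ↥(bset D'.toDomains), Real.exp (-(δ / 4 * (geomT D').dist ⟨y.1, hy.2⟩ u')) := by
          rw [Finset.mul_sum]
          exact Finset.sum_congr rfl fun u' _ => by ring
      _ ≤ KB * Λ * eΩ * c * c := mul_le_mul_of_nonneg_left (sum_exp_le D' h261' ⟨y.1, hy.2⟩)
          (mul_nonneg (mul_nonneg (mul_nonneg hKB0 hΛ0) heΩ0) hc0)
      _ = KB * c ^ 2 * Λ * eΩ := by ring
  -- term C summed
  have hCsum : |∑ u' : ↥(bset D'.toDomains),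
      (∑ w' : ↥(bset D'.toDomains), TL' (lam D' w') x * CinvT D' a w' u')
        * ((if u'.1.1 = k ∧ u'.1 ∈ bset D.toDomains then (S *ᵥ lam D' u') x' else 0)
            - (S' *ᵥ lam D' u') x')| ≤ KC * c * Λ * eΩ := by
    refine (Finset.abs_sum_le_sum_abs _ _).trans ?_
    calc ∑ u' : ↥(bset D'.toDomains), |(∑ w' : ↥(bset D'.toDomains), TL' (lam D' w') x * CinvT D' a w' u')
            * ((if u'.1.1 = k ∧ u'.1 ∈ bset D.toDomains then (S *ᵥ lam D' u') x' else 0)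
                - (S' *ᵥ lam D' u') x')|
        ≤ ∑ u' : ↥(bset D'.toDomains), KC * Λ * eΩ * Real.exp (-(δ / 4 * (geomT D').dist ⟨y.1, hy.2⟩ u')) := by
          refine Finset.sum_le_sum fun u' _ => ?_
          rw [abs_mul]
          have h := termC_le D D' a hMh hP hRM hCE hCG hCΔ hδ hy hy' hE' hF' hC' hΔF hthr2 hthrW h261' u'
          rw [← hΛ, ← hKC, ← heΩ] at h
          exact h
      _ = KC * Λ * eΩ * ∑ u' : ↥(bset D'.toDomains), Real.exp (-(δ / 4 * (geomT D').dist ⟨y.1, hy.2⟩ u')) := by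
          rw [Finset.mul_sum]
      _ ≤ KC * Λ * eΩ * c :=
          mul_le_mul_of_nonneg_left (sum_exp_le D' h261' ⟨y.1, hy.2⟩) (mul_nonneg (mul_nonneg hKC0 hΛ0) heΩ0)
      _ = KC * c * Λ * eΩ := by ring
  -- the identity and the triangle inequality
  rw [word_sub_word D D' a TL TL' S S' x x']
  calc _ ≤ |∑ u : ↥(bset D.toDomains),
          (TL (lam D u) x - (if u.1.1 = k ∧ u.1 ∈ bset D'.toDomains then TL' (lam D u) x else 0))
            * ∑ v : ↥(bset D.toDomains), CinvT D a u v * (S *ᵥ lam D v) x'|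
        + |∑ u' : ↥(bset D'.toDomains), TL' (lam D' u') x *
            ∑ v : ↥(bset D.toDomains),
              ((if h : u'.1.1 = k ∧ u'.1 ∈ bset D.toDomains then CinvT D a ⟨u'.1, h.2⟩ v else 0)
                - (if h : v.1.1 = k ∧ v.1 ∈ bset D'.toDomains then CinvT D' a u' ⟨v.1, h.2⟩ else 0))
              * (S *ᵥ lam D v) x'|
        + |∑ u' : ↥(bset D'.toDomains),
            (∑ w' : ↥(bset D'.toDomains), TL' (lam D' w') x * CinvT D' a w' u')
              * ((if u'.1.1 = k ∧ u'.1 ∈ bset D.toDomains then (S *ᵥ lam D' u') x' else 0)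
                  - (S' *ᵥ lam D' u') x')| := abs_add_three _ _ _
    _ ≤ KA * c * Λ * eΩ + KB * c ^ 2 * Λ * eΩ + KC * c * Λ * eΩ := add_le_add (add_le_add hA hB) hCsum
    _ = _ := by rw [hKA, hKB, hKC, hΛ, heΩ]; ring

end Sum

section Engine

variable {ℓ Mh k R : ℕ} {P : Fin (d + 1) → ℕ} (D D' : TDomains d ℓ Mh k P R) (a : ℕ → ℝ)

/-- **THE ENGINE FOR `P` AND ITS DERIVATIVES**: under the hypotheses of `sum_bound` and the single-family (3.49)-type
bounds of the word in both families (`|w[D](x,x′)| ≤ B_t·Λ·e^{−ρd_D(y,y′)}`, `|w[D′](x,x′)| ≤ B_t·Λ·e^{−ρd_{D′}(y,y′)}`,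
`Λ = L^{n_Lk}L^{n_Rk}L^{−4k}W(y′)⁻¹`):
`|w[D](x,x′) − w[D′](x,x′)| ≤ √(2B_t)·√K_tot·Λ·e^{−½σ·min(d_D,d_{D′})(y,y′)}·e^{−¼σ·d(y,y′,Ω)}`, `σ = min(ρ, ½δ)`
(trivial two-term bound + `sum_bound` + `min(P²F, Q²F) ≤ PQF`).
[cite: Balaban1985BackgroundPropagators, Thm 3.14 (3.154) pp.426–427, (3.49) p.399] -/
theorem p_engine (hMh : 1 ≤ Mh) (hP : ∀ μ, 1 ≤ P μ) (hRM : 1 ≤ R * ((ℓ + 1) * Mh))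
    {TL TL' : Module.End ℝ (↥(boxDom (N0 ℓ Mh k P)) → ℝ)}
    {S S' : Matrix ↥(boxDom (N0 ℓ Mh k P)) ↥(boxDom (N0 ℓ Mh k P)) ℝ} {x x' : ↥(boxDom (N0 ℓ Mh k P))}
    {CE CG CΔ δ c Bt ρ : ℝ} {nL nR : ℕ} (hCE : 0 ≤ CE) (hCG : 0 ≤ CG) (hCΔ : 0 ≤ CΔ) (hδ : 0 < δ)
    (hBt : 0 ≤ Bt) (hρ : 0 < ρ)
    {y y' : ↥(bset D.toDomains)} (hy : y.1.1 = k ∧ y.1 ∈ bset D'.toDomains)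
    (hy' : y'.1.1 = k ∧ y'.1 ∈ bset D'.toDomains)
    (hE : ∀ s : ↥(bset D.toDomains), |TL (lam D s) x|
      ≤ CE * ((ℓ : ℝ) + 1) ^ (nL * k) * Real.exp (-(δ * (geomT D).dist y s)))
    (hE' : ∀ s' : ↥(bset D'.toDomains), |TL' (lam D' s') x|
      ≤ CE * ((ℓ : ℝ) + 1) ^ (nL * k) * Real.exp (-(δ * (geomT D').dist ⟨y.1, hy.2⟩ s')))
    (hF : ∀ s : ↥(bset D.toDomains), |(S *ᵥ lam D s) x'|
      ≤ CE * ((ℓ : ℝ) + 1) ^ (nR * k) * Real.exp (-(δ * (geomT D).dist y' s)))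
    (hF' : ∀ s' : ↥(bset D'.toDomains), |(S' *ᵥ lam D' s') x'|
      ≤ CE * ((ℓ : ℝ) + 1) ^ (nR * k) * Real.exp (-(δ * (geomT D').dist ⟨y'.1, hy'.2⟩ s')))
    (hC : ∀ u v : ↥(bset D.toDomains), |CinvT D a u v|
      ≤ CG * (((ℓ : ℝ) + 1) ^ (4 * u.1.1))⁻¹ * (W D.toDomains v)⁻¹ * Real.exp (-(δ * (geomT D).dist u v)))
    (hC' : ∀ u' v' : ↥(bset D'.toDomains), |CinvT D' a u' v'|
      ≤ CG * (((ℓ : ℝ) + 1) ^ (4 * u'.1.1))⁻¹ * (W D'.toDomains v')⁻¹ * Real.exp (-(δ * (geomT D').dist u' v')))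
    (hΔE : ∀ u : ↥(bset D.toDomains), u.1.1 = k ∧ u.1 ∈ bset D'.toDomains →
      |TL (lam D u) x - TL' (lam D u) x| ≤ CΔ * ((ℓ : ℝ) + 1) ^ (nL * k) * Real.exp (-(δ * dOmega D D' y.1.2 u.1.2)))
    (hΔF : ∀ u' : ↥(bset D'.toDomains), u'.1.1 = k ∧ u'.1 ∈ bset D.toDomains →
      |(S *ᵥ lam D' u') x' - (S' *ᵥ lam D' u') x'|
        ≤ CΔ * ((ℓ : ℝ) + 1) ^ (nR * k) * Real.exp (-(δ * dOmega D D' y'.1.2 u'.1.2)))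
    (hΔC : ∀ (u' : ↥(bset D'.toDomains)) (v : ↥(bset D.toDomains)) (hu' : u'.1.1 = k ∧ u'.1 ∈ bset D.toDomains)
      (hv : v.1.1 = k ∧ v.1 ∈ bset D'.toDomains),
      |CinvT D a ⟨u'.1, hu'.2⟩ v - CinvT D' a u' ⟨v.1, hv.2⟩|
        ≤ CΔ * (((ℓ : ℝ) + 1) ^ (4 * k))⁻¹ * ((((ℓ : ℝ) + 1) ^ k) ^ (d + 1))⁻¹
          * Real.exp (-(δ * dOmega D D' u'.1.2 v.1.2)))
    (hthr2 : ((ℓ : ℝ) + 1) ^ 2 ≤ Real.exp (1 / 4 * (δ / 2) * ((R : ℝ) * (((ℓ : ℝ) + 1) * Mh) - 1)))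
    (hthrW : ((ℓ : ℝ) + 1) ^ (d + 1) ≤ Real.exp (δ / 4 * ((R : ℝ) * (((ℓ : ℝ) + 1) * Mh) - 1)))
    (h261 : Ineq261With c (geomT D) δ (1 / 4)) (h261' : Ineq261With c (geomT D') δ (1 / 4))
    (hT : |TL (QsB D.toDomains (GinvT D a (QB D.toDomains (fun w => S x' w)))) x|
      ≤ Bt * (((ℓ : ℝ) + 1) ^ (nL * k) * ((ℓ : ℝ) + 1) ^ (nR * k) * (((ℓ : ℝ) + 1) ^ (4 * k))⁻¹
          * (W D.toDomains y')⁻¹) * Real.exp (-(ρ * (geomT D).dist y y')))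
    (hT' : |TL' (QsB D'.toDomains (GinvT D' a (QB D'.toDomains (fun w => S' x' w)))) x|
      ≤ Bt * (((ℓ : ℝ) + 1) ^ (nL * k) * ((ℓ : ℝ) + 1) ^ (nR * k) * (((ℓ : ℝ) + 1) ^ (4 * k))⁻¹
          * (W D.toDomains y')⁻¹) * Real.exp (-(ρ * (geomT D').dist ⟨y.1, hy.2⟩ ⟨y'.1, hy'.2⟩))) :
    |TL (QsB D.toDomains (GinvT D a (QB D.toDomains (fun w => S x' w)))) x
        - TL' (QsB D'.toDomains (GinvT D' a (QB D'.toDomains (fun w => S' x' w)))) x|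
      ≤ Real.sqrt (2 * Bt)
        * Real.sqrt (((CΔ + CE * ((ℓ : ℝ) + 1) ^ 4 * Real.exp (δ / 2)) * (CG * CE * c * ((ℓ : ℝ) + 1) ^ (d + 1))
            + (CE * CG * c * ((ℓ : ℝ) + 1) ^ 4) * (CΔ + CE * ((ℓ : ℝ) + 1) ^ (d + 1) * Real.exp (δ / 2))) * c
          + CE ^ 2 * (CΔ + CG * ((ℓ : ℝ) + 1) ^ (d + 1) + CG * ((ℓ : ℝ) + 1) ^ 4) * Real.exp δ * c ^ 2)
        * (((ℓ : ℝ) + 1) ^ (nL * k) * ((ℓ : ℝ) + 1) ^ (nR * k) * (((ℓ : ℝ) + 1) ^ (4 * k))⁻¹ * (W D.toDomains y')⁻¹)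
        * Real.exp (-(1 / 2 * min ρ (δ / 2)
            * min ((geomT D).dist y y') ((geomT D').dist ⟨y.1, hy.2⟩ ⟨y'.1, hy'.2⟩)))
        * Real.exp (-(1 / 4 * min ρ (δ / 2) * dOmega D D' y.1.2 y'.1.2)) := by
  have hc0 : 0 ≤ c := c261_nonneg D h261 y
  have hWy : 0 < (W D.toDomains y')⁻¹ := inv_pos.2 (W_pos D.toDomains y')
  have hd0 := (triangle_refl_nonneg_T D hMh hP).2.2 y y'
  have hd0' := (triangle_refl_nonneg_T D' hMh hP).2.2 ⟨y.1, hy.2⟩ ⟨y'.1, hy'.2⟩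
  have hΛ0 : 0 ≤ ((ℓ : ℝ) + 1) ^ (nL * k) * ((ℓ : ℝ) + 1) ^ (nR * k) * (((ℓ : ℝ) + 1) ^ (4 * k))⁻¹
      * (W D.toDomains y')⁻¹ := by positivity
  have hK0 : 0 ≤ ((CΔ + CE * ((ℓ : ℝ) + 1) ^ 4 * Real.exp (δ / 2)) * (CG * CE * c * ((ℓ : ℝ) + 1) ^ (d + 1))
        + (CE * CG * c * ((ℓ : ℝ) + 1) ^ 4) * (CΔ + CE * ((ℓ : ℝ) + 1) ^ (d + 1) * Real.exp (δ / 2))) * c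
      + CE ^ 2 * (CΔ + CG * ((ℓ : ℝ) + 1) ^ (d + 1) + CG * ((ℓ : ℝ) + 1) ^ 4) * Real.exp δ * c ^ 2 := by positivity
  have hσρ : min ρ (δ / 2) ≤ ρ := min_le_left _ _
  have hσδ : min ρ (δ / 2) ≤ δ / 2 := min_le_right _ _
  have hσ0 : 0 < min ρ (δ / 2) := lt_min hρ (by linarith)
  have hm1 : min ((geomT D).dist y y') ((geomT D').dist ⟨y.1, hy.2⟩ ⟨y'.1, hy'.2⟩) ≤ (geomT D).dist y y' :=
    min_le_left _ _
  have hm2 : min ((geomT D).dist y y') ((geomT D').dist ⟨y.1, hy.2⟩ ⟨y'.1, hy'.2⟩)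
      ≤ (geomT D').dist ⟨y.1, hy.2⟩ ⟨y'.1, hy'.2⟩ := min_le_right _ _
  have hm0 : 0 ≤ min ((geomT D).dist y y') ((geomT D').dist ⟨y.1, hy.2⟩ ⟨y'.1, hy'.2⟩) := le_min hd0 hd0'
  -- the trivial two-term bound
  have h1 : |TL (QsB D.toDomains (GinvT D a (QB D.toDomains (fun w => S x' w)))) x
        - TL' (QsB D'.toDomains (GinvT D' a (QB D'.toDomains (fun w => S' x' w)))) x|
      ≤ 2 * Bt * (((ℓ : ℝ) + 1) ^ (nL * k) * ((ℓ : ℝ) + 1) ^ (nR * k) * (((ℓ : ℝ) + 1) ^ (4 * k))⁻¹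
          * (W D.toDomains y')⁻¹)
        * Real.exp (-(min ρ (δ / 2) * min ((geomT D).dist y y') ((geomT D').dist ⟨y.1, hy.2⟩ ⟨y'.1, hy'.2⟩))) := by
    have e1 : Real.exp (-(ρ * (geomT D).dist y y'))
        ≤ Real.exp (-(min ρ (δ / 2) * min ((geomT D).dist y y') ((geomT D').dist ⟨y.1, hy.2⟩ ⟨y'.1, hy'.2⟩))) :=
      Real.exp_le_exp.2 (by nlinarith [mul_le_mul hσρ hm1 hm0 hρ.le])
    have e2 : Real.exp (-(ρ * (geomT D').dist ⟨y.1, hy.2⟩ ⟨y'.1, hy'.2⟩))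
        ≤ Real.exp (-(min ρ (δ / 2) * min ((geomT D).dist y y') ((geomT D').dist ⟨y.1, hy.2⟩ ⟨y'.1, hy'.2⟩))) :=
      Real.exp_le_exp.2 (by nlinarith [mul_le_mul hσρ hm2 hm0 hρ.le])
    calc _ ≤ |TL (QsB D.toDomains (GinvT D a (QB D.toDomains (fun w => S x' w)))) x|
          + |TL' (QsB D'.toDomains (GinvT D' a (QB D'.toDomains (fun w => S' x' w)))) x| := abs_sub _ _
      _ ≤ _ := add_le_add hT hT'
      _ ≤ Bt * (((ℓ : ℝ) + 1) ^ (nL * k) * ((ℓ : ℝ) + 1) ^ (nR * k) * (((ℓ : ℝ) + 1) ^ (4 * k))⁻¹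
              * (W D.toDomains y')⁻¹)
            * Real.exp (-(min ρ (δ / 2) * min ((geomT D).dist y y') ((geomT D').dist ⟨y.1, hy.2⟩ ⟨y'.1, hy'.2⟩)))
          + Bt * (((ℓ : ℝ) + 1) ^ (nL * k) * ((ℓ : ℝ) + 1) ^ (nR * k) * (((ℓ : ℝ) + 1) ^ (4 * k))⁻¹
              * (W D.toDomains y')⁻¹)
            * Real.exp (-(min ρ (δ / 2) * min ((geomT D).dist y y') ((geomT D').dist ⟨y.1, hy.2⟩ ⟨y'.1, hy'.2⟩))) :=
          add_le_add (mul_le_mul_of_nonneg_left e1 (mul_nonneg hBt hΛ0)) (mul_le_mul_of_nonneg_left e2 (mul_nonneg hBt hΛ0))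
      _ = _ := by ring
  -- the resolvent (telescoping) estimate
  have h2 := sum_bound D D' a hMh hP hRM hCE hCG hCΔ hδ.le hy hy' hE hE' hF hF' hC hC' hΔE hΔF hΔC hthr2 hthrW h261 h261'
  have h2' : |TL (QsB D.toDomains (GinvT D a (QB D.toDomains (fun w => S x' w)))) x
        - TL' (QsB D'.toDomains (GinvT D' a (QB D'.toDomains (fun w => S' x' w)))) x|
      ≤ (((CΔ + CE * ((ℓ : ℝ) + 1) ^ 4 * Real.exp (δ / 2)) * (CG * CE * c * ((ℓ : ℝ) + 1) ^ (d + 1))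
            + (CE * CG * c * ((ℓ : ℝ) + 1) ^ 4) * (CΔ + CE * ((ℓ : ℝ) + 1) ^ (d + 1) * Real.exp (δ / 2))) * c
          + CE ^ 2 * (CΔ + CG * ((ℓ : ℝ) + 1) ^ (d + 1) + CG * ((ℓ : ℝ) + 1) ^ 4) * Real.exp δ * c ^ 2)
        * (((ℓ : ℝ) + 1) ^ (nL * k) * ((ℓ : ℝ) + 1) ^ (nR * k) * (((ℓ : ℝ) + 1) ^ (4 * k))⁻¹ * (W D.toDomains y')⁻¹)
        * Real.exp (-(1 / 2 * min ρ (δ / 2) * dOmega D D' y.1.2 y'.1.2)) := by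
    refine h2.trans (mul_le_mul_of_nonneg_left (Real.exp_le_exp.2 ?_) (mul_nonneg hK0 hΛ0))
    nlinarith [dOmega_nonneg D D' y.1.2 y'.1.2]
  exact combined_bound (by positivity) hK0 hΛ0 h1 h2'

end Engine

/-! ## §2 Reading the torus packages: legs from (2.67)-majorants, the (2.69)-kernel from (2.87), the four words -/

section Inputs

variable {ℓ Mh k R : ℕ} {P : Fin (d + 1) → ℕ}

/-- a (2.67)-type block majorant read on the test functions `λ_s` at a top block `t ∋ z`, rate lowered to `δ`.
[cite: Balaban1984PropagatorsII, (2.51) p.232, (2.67) p.234] -/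
theorem leg_of_hasMajorant (D₀ : TDomains d ℓ Mh k P R) (hMh : 1 ≤ Mh) (hP : ∀ μ, 1 ≤ P μ)
    {T : Module.End ℝ (↥(boxDom (N0 ℓ Mh k P)) → ℝ)} {CE δ' δ : ℝ} (hCE : 0 ≤ CE) (hδ' : δ ≤ δ')
    {n : ℕ}
    (hmaj : HasMajorant (g := geomT D₀) (blkOf D₀.toDomains) T
      (fun y y' => CE * ((ℓ : ℝ) + 1) ^ (n * y.1.1) * Real.exp (-(δ' * (geomT D₀).dist y y'))))
    {t : ↥(bset D₀.toDomains)} (ht : t.1.1 = k) {z : ↥(boxDom (N0 ℓ Mh k P))} (hz : blkOf D₀.toDomains z = t)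
    (s : ↥(bset D₀.toDomains)) :
    |T (lam D₀ s) z| ≤ CE * ((ℓ : ℝ) + 1) ^ (n * k) * Real.exp (-(δ * (geomT D₀).dist t s)) := by
  have h := hmaj s (lam D₀ s) 1 (blockSupp_lam D₀ s) z
  rw [hz] at h
  dsimp only at h
  rw [ht, mul_one] at h
  refine h.trans (mul_le_mul_of_nonneg_left (Real.exp_le_exp.2 ?_) (by positivity))
  nlinarith [(triangle_refl_nonneg_T D₀ hMh hP).2.2 t s]

/-- the (2.87) package read as a bound of the (2.69)-kernel `C = CinvT`: `|C(u,v)| ≤ C_G·L^{−4j(u)}·W(v)⁻¹·e^{−δd(u,v)}`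
for `δ ≤ ½δ₁` (`W(v) = (L^{j(v)})^{d+1}`). [cite: Balaban1984PropagatorsII, Prop. 2.3 (2.87) p.238, (2.69) p.235] -/
theorem cinv_of_prop23 (D₀ : TDomains d ℓ Mh k P R) (hMh : 1 ≤ Mh) (hP : ∀ μ, 1 ≤ P μ) (a : ℕ → ℝ) {C δ₁ δ : ℝ}
    (hC : 0 ≤ C) (hδ₁ : δ ≤ δ₁ / 2)
    (h87 : ∀ y y' : ↥(bset D₀.toDomains), |mat (GinvT D₀ a) y y' / W D₀.toDomains y'| ≤
      C * (geomT D₀).len y ^ (-(4 : ℝ)) * (geomT D₀).len y' ^ (-((d + 1 : ℕ) : ℝ)) *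
        Real.exp (-(δ₁ / 2 * (geomT D₀).dist y y')))
    (u v : ↥(bset D₀.toDomains)) :
    |CinvT D₀ a u v| ≤ C * (((ℓ : ℝ) + 1) ^ (4 * u.1.1))⁻¹ * (W D₀.toDomains v)⁻¹
      * Real.exp (-(δ * (geomT D₀).dist u v)) := by
  have h := h87 u v
  have hlu := lenT_pos D₀ u
  have hlv := lenT_pos D₀ v
  rw [mat_GinvT_div, Real.rpow_neg hlu.le, Real.rpow_neg hlv.le,
    show (4 : ℝ) = ((4 : ℕ) : ℝ) by norm_num, Real.rpow_natCast, Real.rpow_natCast, ← W_eq_lenT_pow] at h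
  have hd := (triangle_refl_nonneg_T D₀ hMh hP).2.2 u v
  have hlen4 : (geomT D₀).len u ^ 4 = ((ℓ : ℝ) + 1) ^ (4 * u.1.1) := by rw [lenT_eq, ← pow_mul, mul_comm]
  have hWv : 0 < (W D₀.toDomains v)⁻¹ := inv_pos.2 (W_pos D₀.toDomains v)
  rw [hlen4] at h
  refine h.trans (mul_le_mul_of_nonneg_left (Real.exp_le_exp.2 (by nlinarith)) (by positivity))

/-- the member `P(x, x′)` of r05's `pProjMLT` as the word with `T = G′`, `S = G′` (`G′δ_{x′} = G′(x′, ·)`, `G′` symmetric).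
[cite: Balaban1985BackgroundPropagators, (3.25) p.394, (3.49) p.399] -/
theorem word_m1 (D₀ : TDomains d ℓ Mh k P R) (a : ℕ → ℝ) (x x' : ↥(boxDom (N0 ℓ Mh k P))) :
    pProjMLT D₀ a (GinvT D₀ a) (Pi.single x' 1) x
      = Matrix.toLin' (gmlT (N0 ℓ Mh k P) ℓ k D₀.lev a)
          (QsB D₀.toDomains (GinvT D₀ a (QB D₀.toDomains (fun w => gmlT (N0 ℓ Mh k P) ℓ k D₀.lev a x' w)))) x := by
  rw [pProjMLT_apply, col_gmlT_eq_row, Matrix.toLin'_apply]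

/-- the member `(∂_μP)(x, x′)`: `T = ∂_μG′`, `S = G′`. [cite: Balaban1985BackgroundPropagators, (3.49) p.399] -/
theorem word_m2 (D₀ : TDomains d ℓ Mh k P R) (a : ℕ → ℝ) (μ : Fin (d + 1)) (x x' : ↥(boxDom (N0 ℓ Mh k P))) :
    (dT (N0 ℓ Mh k P) μ *ᵥ pProjMLT D₀ a (GinvT D₀ a) (Pi.single x' 1)) x
      = Matrix.toLin' (dT (N0 ℓ Mh k P) μ * gmlT (N0 ℓ Mh k P) ℓ k D₀.lev a)
          (QsB D₀.toDomains (GinvT D₀ a (QB D₀.toDomains (fun w => gmlT (N0 ℓ Mh k P) ℓ k D₀.lev a x' w)))) x := by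
  rw [pProjMLT_apply, col_gmlT_eq_row, Matrix.mulVec_mulVec, Matrix.toLin'_apply]

/-- the member `(P∂*_ν)(x, x′)`: `T = G′`, `S = ∂_νG′`. [cite: Balaban1985BackgroundPropagators, (3.49) p.399] -/
theorem word_m3 (D₀ : TDomains d ℓ Mh k P R) (a : ℕ → ℝ) (ν : Fin (d + 1)) (x x' : ↥(boxDom (N0 ℓ Mh k P))) :
    pProjMLT D₀ a (GinvT D₀ a) ((dT (N0 ℓ Mh k P) ν)ᵀ *ᵥ Pi.single x' 1) x
      = Matrix.toLin' (gmlT (N0 ℓ Mh k P) ℓ k D₀.lev a)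
          (QsB D₀.toDomains (GinvT D₀ a (QB D₀.toDomains
            (fun w => (dT (N0 ℓ Mh k P) ν * gmlT (N0 ℓ Mh k P) ℓ k D₀.lev a) x' w)))) x := by
  rw [pProjMLT_apply, Matrix.mulVec_mulVec, col_gmlT_transpose_eq_row, Matrix.toLin'_apply]

/-- the member `(∂_μP∂*_ν)(x, x′)`: `T = ∂_μG′`, `S = ∂_νG′`. [cite: Balaban1985BackgroundPropagators, (3.49) p.399; Balaban1984PropagatorsII, (2.88) p.238] -/
theorem word_m4 (D₀ : TDomains d ℓ Mh k P R) (a : ℕ → ℝ) (μ ν : Fin (d + 1)) (x x' : ↥(boxDom (N0 ℓ Mh k P))) :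
    (dT (N0 ℓ Mh k P) μ *ᵥ pProjMLT D₀ a (GinvT D₀ a) ((dT (N0 ℓ Mh k P) ν)ᵀ *ᵥ Pi.single x' 1)) x
      = Matrix.toLin' (dT (N0 ℓ Mh k P) μ * gmlT (N0 ℓ Mh k P) ℓ k D₀.lev a)
          (QsB D₀.toDomains (GinvT D₀ a (QB D₀.toDomains
            (fun w => (dT (N0 ℓ Mh k P) ν * gmlT (N0 ℓ Mh k P) ℓ k D₀.lev a) x' w)))) x := by
  rw [pProjMLT_apply, Matrix.mulVec_mulVec, Matrix.mulVec_mulVec, col_gmlT_transpose_eq_row, Matrix.toLin'_apply]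

/-- the scale bookkeeping of the four members: `L^{n_Lk}L^{n_Rk}L^{−4k} = ((L^k)^{4−n_L−n_R})⁻¹` for
`(n_L, n_R) ∈ {(2,2), (1,2), (2,1), (1,1)}`. [cite: Balaban1985BackgroundPropagators, (3.49) p.399, dictionary] -/
theorem scale_eq (Lr : ℝ) (hL : Lr ≠ 0) (k nL nR : ℕ) (h : nL + nR ≤ 4) :
    Lr ^ (nL * k) * Lr ^ (nR * k) * (Lr ^ (4 * k))⁻¹ = ((Lr ^ k) ^ (4 - nL - nR))⁻¹ := by
  have e : Lr ^ (4 * k) = Lr ^ (nL * k) * Lr ^ (nR * k) * (Lr ^ k) ^ (4 - nL - nR) := by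
    rw [← pow_mul, ← pow_add, ← pow_add]
    congr 1
    have : 4 - nL - nR + (nL + nR) = 4 := by omega
    calc 4 * k = (4 - nL - nR + (nL + nR)) * k := by rw [this]
      _ = nL * k + nR * k + k * (4 - nL - nR) := by ring
  rw [e]
  have h1 : Lr ^ (nL * k) ≠ 0 := pow_ne_zero _ hL
  have h2 : Lr ^ (nR * k) ≠ 0 := pow_ne_zero _ hL
  field_simp

end Inputs

/-! ## §3 Theorem 3.14 at `U = 1` for `P = I − R`: the four members of (3.49) with the (3.154) factor -/

section Main

variable {ℓ Mh k R : ℕ} {P : Fin (d + 1) → ℕ}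

/-- the final bookkeeping: `√A√K·F·e^{−½σm}·e^{−¼σd_Ω} ≤ (√A√K + 1)·F′·e^{−¼σm}·e^{−¼σd_Ω}` for `F = F′ ≥ 0`.
[cite: Balaban1985BackgroundPropagators, Thm 3.14 (3.154) p.427 («after adjusting a definition of δ₀»), bookkeeping] -/
theorem reshape {X A K F F' m dΩ σ : ℝ} (hm : 0 ≤ m) (hσ : 0 ≤ σ) (hF : F = F') (hF' : 0 ≤ F')
    (h : X ≤ Real.sqrt A * Real.sqrt K * F * Real.exp (-(1 / 2 * σ * m)) * Real.exp (-(1 / 4 * σ * dΩ))) :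
    X ≤ (Real.sqrt A * Real.sqrt K + 1) * F' * Real.exp (-(σ / 4 * m)) * Real.exp (-(σ / 4 * dΩ)) := by
  subst hF
  have h0 : 0 ≤ Real.sqrt A * Real.sqrt K := mul_nonneg (Real.sqrt_nonneg _) (Real.sqrt_nonneg _)
  have e1 : Real.exp (-(1 / 2 * σ * m)) ≤ Real.exp (-(σ / 4 * m)) :=
    Real.exp_le_exp.2 (by nlinarith [mul_nonneg hσ hm])
  have e2 : Real.exp (-(1 / 4 * σ * dΩ)) = Real.exp (-(σ / 4 * dΩ)) := by congr 1; ring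
  rw [e2] at h
  have hrest : 0 ≤ F * Real.exp (-(σ / 4 * m)) * Real.exp (-(σ / 4 * dΩ)) := by positivity
  calc X ≤ _ := h
    _ ≤ Real.sqrt A * Real.sqrt K * F * Real.exp (-(σ / 4 * m)) * Real.exp (-(σ / 4 * dΩ)) :=
        mul_le_mul_of_nonneg_right (mul_le_mul_of_nonneg_left e1 (mul_nonneg h0 hF')) (Real.exp_pos _).le
    _ = Real.sqrt A * Real.sqrt K * (F * Real.exp (-(σ / 4 * m)) * Real.exp (-(σ / 4 * dΩ))) := by ring
    _ ≤ (Real.sqrt A * Real.sqrt K + 1) * (F * Real.exp (-(σ / 4 * m)) * Real.exp (-(σ / 4 * dΩ))) :=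
        mul_le_mul_of_nonneg_right (by linarith) hrest
    _ = _ := by ring

/-- **[B9] THEOREM 3.14 AT `U = 1` FOR PRINT'S `P = I − R = G′Q′*(Q′G′²Q′*)⁻¹Q′G′` ON THE GENUINE `k`-LEVEL TORUS — THE
CHARACTERISTIC INEQUALITIES (3.49) WITH THE FACTOR (3.154), ALL FOUR KERNEL MEMBERS.**  There are `δ, C, M₀ > 0` and
`N₀ ≥ 1` (functions of `d`, `L` and the weight window, NOT of the torus, of `k` or of the families) such that for every `k`,
`M_h ≥ 3` with `L·M_h ≥ M₀` («M sufficiently large»), `R ≥ 2L` with `R·L·M_h ≥ N₀ + 1` («R sufficiently large»), `P_μ ≥ 4`,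
EVERY TWO nested families `D, D′` of the torus (2.1)–(2.2) (levels `1 … k`, `Ω₁ = Ω′₁ = T_η`), windowed weights, every two
top blocks `y, y′` of BOTH families (`y, y′ ∈ Ω^{(k)}`, `Ω = Ω_k ∩ Ω′_k`) and sites `x ∈ B(y)`, `x′ ∈ B(y′)`, with r05's
`P[D] = pProjMLT D a (GinvT D a)` (the word (3.25) with THE inverse of [4] Prop. 2.3 inside) and the periodic forward
differences `∂_μ = dT`:
`|P[D](x,x′) − P[D′](x,x′)| ≤ C·((L^k)^{d+1})⁻¹·E`, `|(∂_μP[D])(x,x′) − (∂_μP[D′])(x,x′)| ≤ C·(L^k)⁻¹((L^k)^{d+1})⁻¹·E`,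
`|(P[D]∂*_ν)(x,x′) − (P[D′]∂*_ν)(x,x′)| ≤ C·(L^k)⁻¹((L^k)^{d+1})⁻¹·E`, `|(∂_μP[D]∂*_ν)(x,x′) − (∂_μP[D′]∂*_ν)(x,x′)| ≤
C·((L^k)²)⁻¹((L^k)^{d+1})⁻¹·E` with `E = e^{−δ·min(d_D(y,y′), d_{D′}(y,y′))}·e^{−δ·d(y,y′,Ω)}` (print (3.49): «[|P(x,x′)|,
|(DP)_μ(x,x′)|, |(PD*)_ν(x,x′)|, |(DPD*)_{μν}(x,x′)|] ≦ O(1)[1, (L^jη)⁻¹, (L^{j′}η)⁻¹, (L^jη)⁻¹(L^{j′}η)⁻¹](L^{j′}η)^{−d}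
e^{−δ₀d(y,y′)}» «with the additional factor exp(−δ₀d(y, y′, Ω))» (3.154), here `j = j′ = k`, lattice units).
Route (declared; `U = 1` admits it): file 1's transfer-telescoping identity + term estimates + (2.61) (`sum_bound`), the
trivial bound (r05's `ineq349_multiLevelTorus_P23` for both families) and `min(P²F,Q²F) ≤ PQF` (`p_engine`); inputs BY NAME:
`prop22_entries1236_multiLevelTorus` ((2.67) legs, both families), `prop23_multiLevelTorus` ((2.87), both families), gen-18
`thm314_Gp_sup_flat_multiLevelTorus` (Theorem 3.14 for `G′`, `∂G′`), `thm314_QGGQinv_flat_multiLevelTorus` (Theorem 3.14 for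
`(Q′G′²Q′*)⁻¹`), (2.60)/(2.61) on the torus (`consts_260_261`, `pow_le_exp_of_threshold`).  The hypotheses are met
(`B9Thm314GpFlatMultiLevelTorus.thm314_Gp_flat_nonvacuous`, same binder shape).
[cite: Balaban1985BackgroundPropagators, Thm 3.14 (3.154) pp.426–427, (3.49) p.399, (3.25) p.394; Balaban1984PropagatorsII, (2.17) p.225, (2.88) p.238] -/
theorem thm314_P_flat_multiLevelTorus (d ℓ : ℕ) (hℓ : 1 ≤ ℓ) (aminus aplus a2minus a2plus : ℝ)
    (ha : 0 < aminus) (ha2 : 0 < a2minus) :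
    ∃ δ C M₀ : ℝ, ∃ N₀ : ℕ, 0 < δ ∧ 0 < C ∧ 0 < M₀ ∧ 0 < N₀ ∧
      ∀ (k Mh R : ℕ), 3 ≤ Mh → M₀ ≤ ((ℓ : ℝ) + 1) * Mh → 2 * (ℓ + 1) ≤ R → N₀ + 1 ≤ R * ((ℓ + 1) * Mh) →
      ∀ (P : Fin (d + 1) → ℕ) (hP : ∀ μ, 1 ≤ P μ) (hP4 : ∀ μ, 4 ≤ P μ) (D D' : TDomains d ℓ Mh k P R)
        (a c : ℕ → ℝ), (∀ i, 1 ≤ i → aminus ≤ a i ∧ a i ≤ aplus) → (∀ i, 1 ≤ i → a2minus ≤ c i ∧ c i ≤ a2plus) →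
        (∀ i, 1 ≤ i → a (i + 1) = aNext ℓ (a i) (c i)) →
      ∀ (p q : ℕ × (Fin (d + 1) → ℤ)) (hpD : p ∈ bset D.toDomains) (hpD' : p ∈ bset D'.toDomains)
        (hqD : q ∈ bset D.toDomains) (hqD' : q ∈ bset D'.toDomains), p.1 = k → q.1 = k →
      ∀ (x x' : ↥(boxDom (N0 ℓ Mh k P))), blkOf D.toDomains x = ⟨p, hpD⟩ → blkOf D.toDomains x' = ⟨q, hqD⟩ →
        |pProjMLT D a (GinvT D a) (Pi.single x' 1) x - pProjMLT D' a (GinvT D' a) (Pi.single x' 1) x|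
            ≤ C * ((((ℓ : ℝ) + 1) ^ k) ^ (d + 1))⁻¹
              * Real.exp (-(δ * min ((geomT D).dist ⟨p, hpD⟩ ⟨q, hqD⟩) ((geomT D').dist ⟨p, hpD'⟩ ⟨q, hqD'⟩)))
              * Real.exp (-(δ * dOmega D D' p.2 q.2)) ∧
        (∀ μ : Fin (d + 1),
          |(dT (N0 ℓ Mh k P) μ *ᵥ pProjMLT D a (GinvT D a) (Pi.single x' 1)) x
              - (dT (N0 ℓ Mh k P) μ *ᵥ pProjMLT D' a (GinvT D' a) (Pi.single x' 1)) x|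
            ≤ C * (((ℓ : ℝ) + 1) ^ k)⁻¹ * ((((ℓ : ℝ) + 1) ^ k) ^ (d + 1))⁻¹
              * Real.exp (-(δ * min ((geomT D).dist ⟨p, hpD⟩ ⟨q, hqD⟩) ((geomT D').dist ⟨p, hpD'⟩ ⟨q, hqD'⟩)))
              * Real.exp (-(δ * dOmega D D' p.2 q.2))) ∧
        (∀ ν : Fin (d + 1),
          |pProjMLT D a (GinvT D a) ((dT (N0 ℓ Mh k P) ν)ᵀ *ᵥ Pi.single x' 1) x
              - pProjMLT D' a (GinvT D' a) ((dT (N0 ℓ Mh k P) ν)ᵀ *ᵥ Pi.single x' 1) x|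
            ≤ C * (((ℓ : ℝ) + 1) ^ k)⁻¹ * ((((ℓ : ℝ) + 1) ^ k) ^ (d + 1))⁻¹
              * Real.exp (-(δ * min ((geomT D).dist ⟨p, hpD⟩ ⟨q, hqD⟩) ((geomT D').dist ⟨p, hpD'⟩ ⟨q, hqD'⟩)))
              * Real.exp (-(δ * dOmega D D' p.2 q.2))) ∧
        (∀ μ ν : Fin (d + 1),
          |(dT (N0 ℓ Mh k P) μ *ᵥ pProjMLT D a (GinvT D a) ((dT (N0 ℓ Mh k P) ν)ᵀ *ᵥ Pi.single x' 1)) x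
              - (dT (N0 ℓ Mh k P) μ *ᵥ pProjMLT D' a (GinvT D' a) ((dT (N0 ℓ Mh k P) ν)ᵀ *ᵥ Pi.single x' 1)) x|
            ≤ C * ((((ℓ : ℝ) + 1) ^ k) ^ 2)⁻¹ * ((((ℓ : ℝ) + 1) ^ k) ^ (d + 1))⁻¹
              * Real.exp (-(δ * min ((geomT D).dist ⟨p, hpD⟩ ⟨q, hqD⟩) ((geomT D').dist ⟨p, hpD'⟩ ⟨q, hqD'⟩)))
              * Real.exp (-(δ * dOmega D D' p.2 q.2))) := by
  obtain ⟨δ₀, C₀, M₀, N₀, hδ₀, hC₀, hM₀, hN₀, h22⟩ :=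
    prop22_entries1236_multiLevelTorus d ℓ hℓ aminus aplus a2minus a2plus ha ha2
  obtain ⟨δ₁, C₁, M₁, hδ₁, hC₁, hM₁, h23⟩ := prop23_multiLevelTorus d ℓ hℓ aminus aplus a2minus a2plus ha ha2
  obtain ⟨δ₂, C₂, M₂, N₂, hδ₂, hC₂, hM₂, hN₂, h314⟩ :=
    thm314_Gp_sup_flat_multiLevelTorus d ℓ hℓ aminus aplus a2minus a2plus ha ha2
  obtain ⟨δ₃, C₃, M₃, N₃, hδ₃, hC₃, hM₃, hN₃, hinv⟩ :=
    thm314_QGGQinv_flat_multiLevelTorus d ℓ hℓ aminus aplus a2minus a2plus ha ha2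
  obtain ⟨ρ, B, M₄, N₄, hρ, hB, hM₄, hN₄, h349⟩ := ineq349_multiLevelTorus_P23 d ℓ hℓ aminus aplus a2minus a2plus ha ha2
  have hL0 : (0 : ℝ) < (ℓ : ℝ) + 1 := by positivity
  have hL1 : (1 : ℝ) ≤ (ℓ : ℝ) + 1 := by linarith [(Nat.cast_nonneg ℓ : (0 : ℝ) ≤ ℓ)]
  -- the common input rate and the common two-family constant
  obtain ⟨δ, hδa, hδb, hδc, hδd, hδpos⟩ : ∃ δ : ℝ, δ ≤ δ₀ / 2 ∧ δ ≤ δ₁ / 2 ∧ δ ≤ δ₂ ∧ δ ≤ δ₃ ∧ 0 < δ :=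
    ⟨min (min (δ₀ / 2) (δ₁ / 2)) (min δ₂ δ₃), (min_le_left _ _).trans (min_le_left _ _),
      (min_le_left _ _).trans (min_le_right _ _), (min_le_right _ _).trans (min_le_left _ _),
      (min_le_right _ _).trans (min_le_right _ _), lt_min (lt_min (by positivity) (by positivity)) (lt_min hδ₂ hδ₃)⟩
  obtain ⟨CΔ, hCa, hCb, hCΔ0⟩ : ∃ CΔ : ℝ, C₂ ≤ CΔ ∧ C₃ ≤ CΔ ∧ 0 ≤ CΔ :=
    ⟨max C₂ C₃, le_max_left _ _, le_max_right _ _, hC₂.le.trans (le_max_left _ _)⟩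
  obtain ⟨N₅, cc, hN₅, hcc0, h261c⟩ := consts_260_261 d ℓ hδpos
  obtain ⟨N₆, c6, hN₆, -, h260c⟩ := consts_260_261 d ℓ (δ := δ / 2) (by positivity)
  obtain ⟨NW, hNW⟩ : ∃ NW : ℕ, NW = ⌈((d : ℝ) + 1) * ((ℓ : ℝ) + 1) / (δ / 4)⌉₊ := ⟨_, rfl⟩
  -- the constant of the sum and the final constant
  obtain ⟨Kt, hKt⟩ : ∃ Kt : ℝ, Kt =
      ((CΔ + C₀ * ((ℓ : ℝ) + 1) ^ 4 * Real.exp (δ / 2)) * (C₁ * C₀ * cc * ((ℓ : ℝ) + 1) ^ (d + 1))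
          + (C₀ * C₁ * cc * ((ℓ : ℝ) + 1) ^ 4) * (CΔ + C₀ * ((ℓ : ℝ) + 1) ^ (d + 1) * Real.exp (δ / 2))) * cc
        + C₀ ^ 2 * (CΔ + C₁ * ((ℓ : ℝ) + 1) ^ (d + 1) + C₁ * ((ℓ : ℝ) + 1) ^ 4) * Real.exp δ * cc ^ 2 := ⟨_, rfl⟩
  have hσ0 : 0 < min ρ (δ / 2) := lt_min hρ (by positivity)
  refine ⟨min ρ (δ / 2) / 4, Real.sqrt (2 * B) * Real.sqrt Kt + 1, max (max (max M₀ M₁) (max M₂ M₃)) M₄,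
    max (max (max N₀ N₂) (max N₃ N₄)) (max (max N₅ N₆) NW), by positivity, by positivity,
    lt_of_lt_of_le hM₀ ((le_max_left _ _).trans ((le_max_left _ _).trans (le_max_left _ _))),
    lt_of_lt_of_le hN₀ ((le_max_left _ _).trans ((le_max_left _ _).trans (le_max_left _ _))), ?_⟩
  intro k Mh R hMh hM hR hRM P hP hP4 D D' a c haw hcw hac p q hpD hpD' hqD hqD' hp hq x x' hx hx'
  have hMh1 : 1 ≤ Mh := le_trans (by norm_num) hMh
  -- «M and R sufficiently large» for every input
  have hM0 : M₀ ≤ ((ℓ : ℝ) + 1) * Mh := le_trans ((le_max_left _ _).trans ((le_max_left _ _).trans (le_max_left _ _))) hM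
  have hM1 : M₁ ≤ ((ℓ : ℝ) + 1) * Mh := le_trans ((le_max_right _ _).trans ((le_max_left _ _).trans (le_max_left _ _))) hM
  have hM2 : M₂ ≤ ((ℓ : ℝ) + 1) * Mh := le_trans ((le_max_left _ _).trans ((le_max_right _ _).trans (le_max_left _ _))) hM
  have hM3 : M₃ ≤ ((ℓ : ℝ) + 1) * Mh :=
    le_trans ((le_max_right _ _).trans ((le_max_right _ _).trans (le_max_left _ _))) hM
  have hM4 : M₄ ≤ ((ℓ : ℝ) + 1) * Mh := le_trans (le_max_right _ _) hM
  have hN : ∀ {n : ℕ}, n ≤ max (max (max N₀ N₂) (max N₃ N₄)) (max (max N₅ N₆) NW) → n + 1 ≤ R * ((ℓ + 1) * Mh) :=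
    fun hn => le_trans (Nat.add_le_add_right hn 1) hRM
  have hRM0 := hN ((le_max_left _ _).trans ((le_max_left _ _).trans (le_max_left _ _)))
  have hRM2 := hN ((le_max_right _ _).trans ((le_max_left _ _).trans (le_max_left _ _)))
  have hRM3 := hN ((le_max_left N₃ N₄).trans ((le_max_right _ _).trans (le_max_left _ _)))
  have hRM4 := hN ((le_max_right N₃ N₄).trans ((le_max_right _ _).trans (le_max_left _ _)))
  have hRM5 := hN ((le_max_left N₅ N₆).trans ((le_max_left _ _).trans (le_max_right _ _)))
  have hRM6 := hN ((le_max_right N₅ N₆).trans ((le_max_left _ _).trans (le_max_right _ _)))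
  have hRMW := hN ((le_max_right _ NW).trans (le_max_right _ _))
  have hRMone : 1 ≤ R * ((ℓ + 1) * Mh) := le_trans (by omega) hRM5
  -- the packages for the two families
  obtain ⟨hTG, hTD, -, -⟩ := h22 k Mh R hMh hM0 hR hRM0 P hP hP4 D a c haw hcw hac
  obtain ⟨hTG', hTD', -, -⟩ := h22 k Mh R hMh hM0 hR hRM0 P hP hP4 D' a c haw hcw hac
  obtain ⟨-, -, -, hG⟩ := h23 k Mh R hM1 hR P hP hP4 D a c haw hcw hac
  obtain ⟨-, -, -, hG'⟩ := h23 k Mh R hM1 hR P hP hP4 D' a c haw hcw hac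
  have h314' := h314 k Mh R hMh hM2 hR hRM2 P hP hP4 D D' a c haw hcw hac
  have hinv' := hinv k Mh R hMh hM3 hR hRM3 P hP hP4 D D' a c haw hcw hac
  obtain ⟨-, -, -, -, h349D⟩ := h349 k Mh R hMh hM4 hR hRM4 P hP hP4 D a c haw hcw hac
  obtain ⟨-, -, -, -, h349D'⟩ := h349 k Mh R hMh hM4 hR hRM4 P hP hP4 D' a c haw hcw hac
  have h261D : Ineq261With cc (geomT D) δ (1 / 4) := (h261c k Mh R P hMh1 hP hRM5).2 D
  have h261D' : Ineq261With cc (geomT D') δ (1 / 4) := (h261c k Mh R P hMh1 hP hRM5).2 D'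
  have hthr2 : ((ℓ : ℝ) + 1) ^ 2 ≤ Real.exp (1 / 4 * (δ / 2) * ((R : ℝ) * (((ℓ : ℝ) + 1) * Mh) - 1)) :=
    (h260c k Mh R P hMh1 hP hRM6).1
  have hthrW : ((ℓ : ℝ) + 1) ^ (d + 1) ≤ Real.exp (δ / 4 * ((R : ℝ) * (((ℓ : ℝ) + 1) * Mh) - 1)) := by
    refine pow_le_exp_of_threshold hL1 (by positivity) (d + 1) ?_
    have h1 : ((d : ℝ) + 1) * ((ℓ : ℝ) + 1) / (δ / 4) ≤ NW := by rw [hNW]; exact Nat.le_ceil _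
    have h2 : ((NW : ℕ) : ℝ) + 1 ≤ (R : ℝ) * (((ℓ : ℝ) + 1) * Mh) := by exact_mod_cast hRMW
    push_cast
    linarith
  -- the two top blocks in both families, the sites
  have hy : (⟨p, hpD⟩ : ↥(bset D.toDomains)).1.1 = k ∧ (⟨p, hpD⟩ : ↥(bset D.toDomains)).1 ∈ bset D'.toDomains :=
    ⟨hp, hpD'⟩
  have hy' : (⟨q, hqD⟩ : ↥(bset D.toDomains)).1.1 = k ∧ (⟨q, hqD⟩ : ↥(bset D.toDomains)).1 ∈ bset D'.toDomains :=
    ⟨hq, hqD'⟩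
  have hxD' : blkOf D'.toDomains x = ⟨p, hpD'⟩ := (blkOf_eq_iff_blkOf_eq D D' hpD hpD' x).1 hx
  have hx'D' : blkOf D'.toDomains x' = ⟨q, hqD'⟩ := (blkOf_eq_iff_blkOf_eq D D' hqD hqD' x').1 hx'
  have hlev : D.lev x.1 = k := by
    have h := lev_eq_of_blkOf_eq D.toDomains hx
    rw [TDomains.toDomains_lev] at h
    exact h.trans hp
  have hlev' : D'.lev x.1 = k := by
    have h := lev_eq_of_blkOf_eq D'.toDomains hxD'
    rw [TDomains.toDomains_lev] at h
    exact h.trans hp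
  have hm0 : 0 ≤ min ((geomT D).dist ⟨p, hpD⟩ ⟨q, hqD⟩) ((geomT D').dist ⟨p, hpD'⟩ ⟨q, hqD'⟩) :=
    le_min ((triangle_refl_nonneg_T D hMh1 hP).2.2 _ _) ((triangle_refl_nonneg_T D' hMh1 hP).2.2 _ _)
  have hLk0 : (0 : ℝ) < ((ℓ : ℝ) + 1) ^ k := pow_pos hL0 k
  have hvol0 : (0 : ℝ) ≤ ((((ℓ : ℝ) + 1) ^ k) ^ (d + 1))⁻¹ := inv_nonneg.2 (pow_nonneg hLk0.le _)
  have hWq : (W D.toDomains ⟨q, hqD⟩)⁻¹ = ((((ℓ : ℝ) + 1) ^ k) ^ (d + 1))⁻¹ := by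
    rw [W_eq]
    show ((((ℓ : ℝ) + 1) ^ q.1) ^ (d + 1))⁻¹ = _
    rw [hq]
  have hWq' : W D'.toDomains ⟨q, hqD'⟩ = W D.toDomains ⟨q, hqD⟩ := (W_common D D' hqD hqD').symm
  -- the (2.69)-kernels of both families and their difference on common top pairs
  have hC := cinv_of_prop23 D hMh1 hP a hC₁.le hδb hG
  have hC' := cinv_of_prop23 D' hMh1 hP a hC₁.le hδb hG'
  have hΔC : ∀ (u' : ↥(bset D'.toDomains)) (v : ↥(bset D.toDomains)) (hu' : u'.1.1 = k ∧ u'.1 ∈ bset D.toDomains)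
      (hv : v.1.1 = k ∧ v.1 ∈ bset D'.toDomains),
      |CinvT D a ⟨u'.1, hu'.2⟩ v - CinvT D' a u' ⟨v.1, hv.2⟩|
        ≤ CΔ * (((ℓ : ℝ) + 1) ^ (4 * k))⁻¹ * ((((ℓ : ℝ) + 1) ^ k) ^ (d + 1))⁻¹
          * Real.exp (-(δ * dOmega D D' u'.1.2 v.1.2)) := by
    intro u' v hu' hv
    have h := (hinv' u'.1 v.1 hu'.2 u'.2 v.2 hv.2 hu'.1 hv.1).2
    rw [Subtype.coe_eta, Subtype.coe_eta, mat_GinvT_div, mat_GinvT_div] at h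
    refine h.trans ?_
    have hmin : 0 ≤ min ((geomT D).dist ⟨u'.1, hu'.2⟩ v) ((geomT D').dist u' ⟨v.1, hv.2⟩) :=
      le_min ((triangle_refl_nonneg_T D hMh1 hP).2.2 _ _) ((triangle_refl_nonneg_T D' hMh1 hP).2.2 _ _)
    have e1 : Real.exp (-(δ₃ * min ((geomT D).dist ⟨u'.1, hu'.2⟩ v) ((geomT D').dist u' ⟨v.1, hv.2⟩))) ≤ 1 :=
      Real.exp_le_one_iff.2 (neg_nonpos.2 (mul_nonneg hδ₃.le hmin))
    have e2 : Real.exp (-(δ₃ * dOmega D D' u'.1.2 v.1.2)) ≤ Real.exp (-(δ * dOmega D D' u'.1.2 v.1.2)) :=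
      Real.exp_le_exp.2 (neg_le_neg (mul_le_mul_of_nonneg_right hδd (dOmega_nonneg D D' u'.1.2 v.1.2)))
    have hL4 : (0 : ℝ) ≤ (((ℓ : ℝ) + 1) ^ (4 * k))⁻¹ := inv_nonneg.2 (pow_nonneg hL0.le _)
    calc C₃ * (((ℓ : ℝ) + 1) ^ (4 * k))⁻¹ * ((((ℓ : ℝ) + 1) ^ k) ^ (d + 1))⁻¹
          * Real.exp (-(δ₃ * min ((geomT D).dist ⟨u'.1, hu'.2⟩ v) ((geomT D').dist u' ⟨v.1, hv.2⟩)))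
          * Real.exp (-(δ₃ * dOmega D D' u'.1.2 v.1.2))
        ≤ CΔ * (((ℓ : ℝ) + 1) ^ (4 * k))⁻¹ * ((((ℓ : ℝ) + 1) ^ k) ^ (d + 1))⁻¹ * 1
          * Real.exp (-(δ * dOmega D D' u'.1.2 v.1.2)) :=
          mul_le_mul (mul_le_mul (mul_le_mul_of_nonneg_right (mul_le_mul_of_nonneg_right hCb hL4) hvol0) e1
            (Real.exp_pos _).le (mul_nonneg (mul_nonneg hCΔ0 hL4) hvol0)) e2 (Real.exp_pos _).le
            (mul_nonneg (mul_nonneg (mul_nonneg hCΔ0 hL4) hvol0) zero_le_one)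
      _ = _ := by rw [mul_one]
  -- the legs (both families, both letters), read at the top blocks `y ∋ x`, `y′ ∋ x′`
  have hTD1 : ∀ μ, HasMajorant (g := geomT D) (blkOf D.toDomains)
      (Matrix.toLin' (dT (N0 ℓ Mh k P) μ * gmlT (N0 ℓ Mh k P) ℓ k D.lev a))
      (fun y y' => C₀ * ((ℓ : ℝ) + 1) ^ (1 * y.1.1) * Real.exp (-(δ₀ / 2 * (geomT D).dist y y'))) :=
    fun μ => hasMajorant_of_eq D (hTD μ) (fun y y' => by rw [one_mul])
  have hTD1' : ∀ μ, HasMajorant (g := geomT D') (blkOf D'.toDomains)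
      (Matrix.toLin' (dT (N0 ℓ Mh k P) μ * gmlT (N0 ℓ Mh k P) ℓ k D'.lev a))
      (fun y y' => C₀ * ((ℓ : ℝ) + 1) ^ (1 * y.1.1) * Real.exp (-(δ₀ / 2 * (geomT D').dist y y'))) :=
    fun μ => hasMajorant_of_eq D' (hTD' μ) (fun y y' => by rw [one_mul])
  have hE1 := leg_of_hasMajorant D hMh1 hP hC₀.le hδa hTG (t := ⟨p, hpD⟩) hp hx
  have hE1' := leg_of_hasMajorant D' hMh1 hP hC₀.le hδa hTG' (t := ⟨p, hpD'⟩) hp hxD'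
  have hE2 := fun μ => leg_of_hasMajorant D hMh1 hP hC₀.le hδa (hTD1 μ) (t := ⟨p, hpD⟩) hp hx
  have hE2' := fun μ => leg_of_hasMajorant D' hMh1 hP hC₀.le hδa (hTD1' μ) (t := ⟨p, hpD'⟩) hp hxD'
  have hF1 : ∀ s : ↥(bset D.toDomains), |(gmlT (N0 ℓ Mh k P) ℓ k D.lev a *ᵥ lam D s) x'|
      ≤ C₀ * ((ℓ : ℝ) + 1) ^ (2 * k) * Real.exp (-(δ * (geomT D).dist ⟨q, hqD⟩ s)) := fun s => by
    have h := leg_of_hasMajorant D hMh1 hP hC₀.le hδa hTG (t := ⟨q, hqD⟩) hq hx' s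
    rwa [Matrix.toLin'_apply] at h
  have hF1' : ∀ s' : ↥(bset D'.toDomains), |(gmlT (N0 ℓ Mh k P) ℓ k D'.lev a *ᵥ lam D' s') x'|
      ≤ C₀ * ((ℓ : ℝ) + 1) ^ (2 * k) * Real.exp (-(δ * (geomT D').dist ⟨q, hqD'⟩ s')) := fun s' => by
    have h := leg_of_hasMajorant D' hMh1 hP hC₀.le hδa hTG' (t := ⟨q, hqD'⟩) hq hx'D' s'
    rwa [Matrix.toLin'_apply] at h
  have hF2 : ∀ (ν : Fin (d + 1)) (s : ↥(bset D.toDomains)),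
      |((dT (N0 ℓ Mh k P) ν * gmlT (N0 ℓ Mh k P) ℓ k D.lev a) *ᵥ lam D s) x'|
        ≤ C₀ * ((ℓ : ℝ) + 1) ^ (1 * k) * Real.exp (-(δ * (geomT D).dist ⟨q, hqD⟩ s)) := fun ν s => by
    have h := leg_of_hasMajorant D hMh1 hP hC₀.le hδa (hTD1 ν) (t := ⟨q, hqD⟩) hq hx' s
    rwa [Matrix.toLin'_apply] at h
  have hF2' : ∀ (ν : Fin (d + 1)) (s' : ↥(bset D'.toDomains)),
      |((dT (N0 ℓ Mh k P) ν * gmlT (N0 ℓ Mh k P) ℓ k D'.lev a) *ᵥ lam D' s') x'|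
        ≤ C₀ * ((ℓ : ℝ) + 1) ^ (1 * k) * Real.exp (-(δ * (geomT D').dist ⟨q, hqD'⟩ s')) := fun ν s' => by
    have h := leg_of_hasMajorant D' hMh1 hP hC₀.le hδa (hTD1' ν) (t := ⟨q, hqD'⟩) hq hx'D' s'
    rwa [Matrix.toLin'_apply] at h
  -- the two-family differences of the letters on common top blocks (gen-18 Theorem 3.14 for `G′`, `∂G′`)
  have weak : ∀ {X t dΩ : ℝ} (e : ℕ), 0 ≤ t → 0 ≤ dΩ →
      X ≤ C₂ * ((ℓ : ℝ) + 1) ^ e * Real.exp (-(δ₂ * t)) * Real.exp (-(δ₂ * dΩ)) * 1 →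
      X ≤ CΔ * ((ℓ : ℝ) + 1) ^ e * Real.exp (-(δ * dΩ)) := by
    intro X t dΩ e ht hΩ h
    refine h.trans ?_
    have e1 : Real.exp (-(δ₂ * t)) ≤ 1 := Real.exp_le_one_iff.2 (neg_nonpos.2 (mul_nonneg hδ₂.le ht))
    have e2 : Real.exp (-(δ₂ * dΩ)) ≤ Real.exp (-(δ * dΩ)) :=
      Real.exp_le_exp.2 (neg_le_neg (mul_le_mul_of_nonneg_right hδc hΩ))
    have hLn : (0 : ℝ) ≤ ((ℓ : ℝ) + 1) ^ e := pow_nonneg hL0.le _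
    rw [mul_one]
    calc C₂ * ((ℓ : ℝ) + 1) ^ e * Real.exp (-(δ₂ * t)) * Real.exp (-(δ₂ * dΩ))
        ≤ CΔ * ((ℓ : ℝ) + 1) ^ e * 1 * Real.exp (-(δ * dΩ)) :=
          mul_le_mul (mul_le_mul (mul_le_mul_of_nonneg_right hCa hLn) e1 (Real.exp_pos _).le
            (mul_nonneg hCΔ0 hLn)) e2 (Real.exp_pos _).le (mul_nonneg (mul_nonneg hCΔ0 hLn) zero_le_one)
      _ = _ := by rw [mul_one]
  have hmin0 : ∀ (u : ↥(bset D.toDomains)) (u' : ↥(bset D'.toDomains)) (v : ↥(bset D.toDomains))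
      (v' : ↥(bset D'.toDomains)), 0 ≤ min ((geomT D).dist u v) ((geomT D').dist u' v') :=
    fun u u' v v' => le_min ((triangle_refl_nonneg_T D hMh1 hP).2.2 _ _) ((triangle_refl_nonneg_T D' hMh1 hP).2.2 _ _)
  have hΔE1 : ∀ u : ↥(bset D.toDomains), u.1.1 = k ∧ u.1 ∈ bset D'.toDomains →
      |Matrix.toLin' (gmlT (N0 ℓ Mh k P) ℓ k D.lev a) (lam D u) x
          - Matrix.toLin' (gmlT (N0 ℓ Mh k P) ℓ k D'.lev a) (lam D u) x|
        ≤ CΔ * ((ℓ : ℝ) + 1) ^ (2 * k) * Real.exp (-(δ * dOmega D D' p.2 u.1.2)) := by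
    intro u hu
    have h := (h314' p u.1 hpD hpD' u.2 hu.2 hp hu.1 (lam D u) 1 (blockSupp_lam D u) x hx).1
    rw [Matrix.sub_mulVec, Pi.sub_apply] at h
    rw [Matrix.toLin'_apply, Matrix.toLin'_apply]
    exact weak (2 * k) (hmin0 _ _ _ _) (dOmega_nonneg D D' _ _) h
  have hΔE2 : ∀ (μ : Fin (d + 1)) (u : ↥(bset D.toDomains)), u.1.1 = k ∧ u.1 ∈ bset D'.toDomains →
      |Matrix.toLin' (dT (N0 ℓ Mh k P) μ * gmlT (N0 ℓ Mh k P) ℓ k D.lev a) (lam D u) x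
          - Matrix.toLin' (dT (N0 ℓ Mh k P) μ * gmlT (N0 ℓ Mh k P) ℓ k D'.lev a) (lam D u) x|
        ≤ CΔ * ((ℓ : ℝ) + 1) ^ (1 * k) * Real.exp (-(δ * dOmega D D' p.2 u.1.2)) := by
    intro μ u hu
    have h := (h314' p u.1 hpD hpD' u.2 hu.2 hp hu.1 (lam D u) 1 (blockSupp_lam D u) x hx).2.1 μ
    rw [Matrix.sub_mulVec, Pi.sub_apply] at h
    rw [Matrix.toLin'_apply, Matrix.toLin'_apply, one_mul]
    exact weak k (hmin0 _ _ _ _) (dOmega_nonneg D D' _ _) h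
  have hΔF1 : ∀ u' : ↥(bset D'.toDomains), u'.1.1 = k ∧ u'.1 ∈ bset D.toDomains →
      |(gmlT (N0 ℓ Mh k P) ℓ k D.lev a *ᵥ lam D' u') x' - (gmlT (N0 ℓ Mh k P) ℓ k D'.lev a *ᵥ lam D' u') x'|
        ≤ CΔ * ((ℓ : ℝ) + 1) ^ (2 * k) * Real.exp (-(δ * dOmega D D' q.2 u'.1.2)) := by
    intro u' hu'
    have hl : lam D' u' = lam D ⟨u'.1, hu'.2⟩ := (lam_common D D' hu'.2 u'.2).symm
    rw [hl]
    have h := (h314' q u'.1 hqD hqD' hu'.2 u'.2 hq hu'.1 (lam D ⟨u'.1, hu'.2⟩) 1 (blockSupp_lam D ⟨u'.1, hu'.2⟩)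
      x' hx').1
    rw [Matrix.sub_mulVec, Pi.sub_apply] at h
    exact weak (2 * k) (hmin0 _ _ _ _) (dOmega_nonneg D D' _ _) h
  have hΔF2 : ∀ (ν : Fin (d + 1)) (u' : ↥(bset D'.toDomains)), u'.1.1 = k ∧ u'.1 ∈ bset D.toDomains →
      |((dT (N0 ℓ Mh k P) ν * gmlT (N0 ℓ Mh k P) ℓ k D.lev a) *ᵥ lam D' u') x'
          - ((dT (N0 ℓ Mh k P) ν * gmlT (N0 ℓ Mh k P) ℓ k D'.lev a) *ᵥ lam D' u') x'|
        ≤ CΔ * ((ℓ : ℝ) + 1) ^ (1 * k) * Real.exp (-(δ * dOmega D D' q.2 u'.1.2)) := by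
    intro ν u' hu'
    have hl : lam D' u' = lam D ⟨u'.1, hu'.2⟩ := (lam_common D D' hu'.2 u'.2).symm
    rw [hl]
    have h := (h314' q u'.1 hqD hqD' hu'.2 u'.2 hq hu'.1 (lam D ⟨u'.1, hu'.2⟩) 1 (blockSupp_lam D ⟨u'.1, hu'.2⟩)
      x' hx').2.1 ν
    rw [Matrix.sub_mulVec, Pi.sub_apply] at h
    rw [one_mul]
    exact weak k (hmin0 _ _ _ _) (dOmega_nonneg D D' _ _) h
  -- the scale prefactors of the four members
  have s22 : ((ℓ : ℝ) + 1) ^ (2 * k) * ((ℓ : ℝ) + 1) ^ (2 * k) * (((ℓ : ℝ) + 1) ^ (4 * k))⁻¹ = 1 := by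
    rw [scale_eq _ hL0.ne' k 2 2 (by norm_num)]; norm_num
  have s12 : ((ℓ : ℝ) + 1) ^ (1 * k) * ((ℓ : ℝ) + 1) ^ (2 * k) * (((ℓ : ℝ) + 1) ^ (4 * k))⁻¹
      = (((ℓ : ℝ) + 1) ^ k)⁻¹ := by
    rw [scale_eq _ hL0.ne' k 1 2 (by norm_num)]; norm_num
  have s21 : ((ℓ : ℝ) + 1) ^ (2 * k) * ((ℓ : ℝ) + 1) ^ (1 * k) * (((ℓ : ℝ) + 1) ^ (4 * k))⁻¹
      = (((ℓ : ℝ) + 1) ^ k)⁻¹ := by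
    rw [scale_eq _ hL0.ne' k 2 1 (by norm_num)]; norm_num
  have s11 : ((ℓ : ℝ) + 1) ^ (1 * k) * ((ℓ : ℝ) + 1) ^ (1 * k) * (((ℓ : ℝ) + 1) ^ (4 * k))⁻¹
      = ((((ℓ : ℝ) + 1) ^ k) ^ 2)⁻¹ := by
    rw [scale_eq _ hL0.ne' k 1 1 (by norm_num)]
  refine ⟨?_, fun μ => ?_, fun ν => ?_, fun μ ν => ?_⟩
  · -- member `P`
    have hT := (h349D x x').1
    rw [word_m1, hx, hx'] at hT
    have hT' := (h349D' x x').1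
    rw [word_m1, hxD', hx'D', hWq'] at hT'
    have hTe : |Matrix.toLin' (gmlT (N0 ℓ Mh k P) ℓ k D.lev a) (QsB D.toDomains (GinvT D a
        (QB D.toDomains (fun w => gmlT (N0 ℓ Mh k P) ℓ k D.lev a x' w)))) x|
        ≤ B * (((ℓ : ℝ) + 1) ^ (2 * k) * ((ℓ : ℝ) + 1) ^ (2 * k) * (((ℓ : ℝ) + 1) ^ (4 * k))⁻¹
            * (W D.toDomains ⟨q, hqD⟩)⁻¹) * Real.exp (-(ρ * (geomT D).dist ⟨p, hpD⟩ ⟨q, hqD⟩)) := by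
      rw [s22, one_mul]; exact hT
    have hTe' : |Matrix.toLin' (gmlT (N0 ℓ Mh k P) ℓ k D'.lev a) (QsB D'.toDomains (GinvT D' a
        (QB D'.toDomains (fun w => gmlT (N0 ℓ Mh k P) ℓ k D'.lev a x' w)))) x|
        ≤ B * (((ℓ : ℝ) + 1) ^ (2 * k) * ((ℓ : ℝ) + 1) ^ (2 * k) * (((ℓ : ℝ) + 1) ^ (4 * k))⁻¹
            * (W D.toDomains ⟨q, hqD⟩)⁻¹) * Real.exp (-(ρ * (geomT D').dist ⟨p, hpD'⟩ ⟨q, hqD'⟩)) := by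
      rw [s22, one_mul]; exact hT'
    have r := p_engine D D' a hMh1 hP hRMone (nL := 2) (nR := 2) hC₀.le hC₁.le hCΔ0 hδpos hB.le hρ hy hy'
      hE1 hE1' hF1 hF1' hC hC' hΔE1 hΔF1 hΔC hthr2 hthrW h261D h261D' hTe hTe'
    rw [← hKt] at r
    rw [word_m1, word_m1]
    refine (reshape hm0 hσ0.le (by rw [s22, one_mul, hWq]) hvol0 r).trans (le_of_eq ?_)
    ring
  · -- member `∂_μP`
    have hT := (h349D x x').2.1 μ
    rw [word_m2, hx, hx', hlev] at hT
    have hT' := (h349D' x x').2.1 μ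
    rw [word_m2, hxD', hx'D', hWq', hlev'] at hT'
    have hTe : |Matrix.toLin' (dT (N0 ℓ Mh k P) μ * gmlT (N0 ℓ Mh k P) ℓ k D.lev a) (QsB D.toDomains (GinvT D a
        (QB D.toDomains (fun w => gmlT (N0 ℓ Mh k P) ℓ k D.lev a x' w)))) x|
        ≤ B * (((ℓ : ℝ) + 1) ^ (1 * k) * ((ℓ : ℝ) + 1) ^ (2 * k) * (((ℓ : ℝ) + 1) ^ (4 * k))⁻¹
            * (W D.toDomains ⟨q, hqD⟩)⁻¹) * Real.exp (-(ρ * (geomT D).dist ⟨p, hpD⟩ ⟨q, hqD⟩)) := by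
      calc _ ≤ _ := hT
        _ = _ := by rw [s12]; ring
    have hTe' : |Matrix.toLin' (dT (N0 ℓ Mh k P) μ * gmlT (N0 ℓ Mh k P) ℓ k D'.lev a) (QsB D'.toDomains (GinvT D' a
        (QB D'.toDomains (fun w => gmlT (N0 ℓ Mh k P) ℓ k D'.lev a x' w)))) x|
        ≤ B * (((ℓ : ℝ) + 1) ^ (1 * k) * ((ℓ : ℝ) + 1) ^ (2 * k) * (((ℓ : ℝ) + 1) ^ (4 * k))⁻¹
            * (W D.toDomains ⟨q, hqD⟩)⁻¹) * Real.exp (-(ρ * (geomT D').dist ⟨p, hpD'⟩ ⟨q, hqD'⟩)) := by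
      calc _ ≤ _ := hT'
        _ = _ := by rw [s12]; ring
    have r := p_engine D D' a hMh1 hP hRMone (nL := 1) (nR := 2) hC₀.le hC₁.le hCΔ0 hδpos hB.le hρ hy hy'
      (hE2 μ) (hE2' μ) hF1 hF1' hC hC' (hΔE2 μ) hΔF1 hΔC hthr2 hthrW h261D h261D' hTe hTe'
    rw [← hKt] at r
    rw [word_m2, word_m2]
    refine (reshape hm0 hσ0.le (by rw [s12, hWq]) (mul_nonneg (inv_pos.2 hLk0).le hvol0) r).trans (le_of_eq ?_)
    ring
  · -- member `P∂*_ν`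
    have hT := (h349D x x').2.2.1 ν
    rw [word_m3, hx, hx', hlev] at hT
    have hT' := (h349D' x x').2.2.1 ν
    rw [word_m3, hxD', hx'D', hWq', hlev'] at hT'
    have hTe : |Matrix.toLin' (gmlT (N0 ℓ Mh k P) ℓ k D.lev a) (QsB D.toDomains (GinvT D a
        (QB D.toDomains (fun w => (dT (N0 ℓ Mh k P) ν * gmlT (N0 ℓ Mh k P) ℓ k D.lev a) x' w)))) x|
        ≤ B * (((ℓ : ℝ) + 1) ^ (2 * k) * ((ℓ : ℝ) + 1) ^ (1 * k) * (((ℓ : ℝ) + 1) ^ (4 * k))⁻¹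
            * (W D.toDomains ⟨q, hqD⟩)⁻¹) * Real.exp (-(ρ * (geomT D).dist ⟨p, hpD⟩ ⟨q, hqD⟩)) := by
      calc _ ≤ _ := hT
        _ = _ := by rw [s21]; ring
    have hTe' : |Matrix.toLin' (gmlT (N0 ℓ Mh k P) ℓ k D'.lev a) (QsB D'.toDomains (GinvT D' a
        (QB D'.toDomains (fun w => (dT (N0 ℓ Mh k P) ν * gmlT (N0 ℓ Mh k P) ℓ k D'.lev a) x' w)))) x|
        ≤ B * (((ℓ : ℝ) + 1) ^ (2 * k) * ((ℓ : ℝ) + 1) ^ (1 * k) * (((ℓ : ℝ) + 1) ^ (4 * k))⁻¹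
            * (W D.toDomains ⟨q, hqD⟩)⁻¹) * Real.exp (-(ρ * (geomT D').dist ⟨p, hpD'⟩ ⟨q, hqD'⟩)) := by
      calc _ ≤ _ := hT'
        _ = _ := by rw [s21]; ring
    have r := p_engine D D' a hMh1 hP hRMone (nL := 2) (nR := 1) hC₀.le hC₁.le hCΔ0 hδpos hB.le hρ hy hy'
      hE1 hE1' (hF2 ν) (hF2' ν) hC hC' hΔE1 (hΔF2 ν) hΔC hthr2 hthrW h261D h261D' hTe hTe'
    rw [← hKt] at r
    rw [word_m3, word_m3]
    refine (reshape hm0 hσ0.le (by rw [s21, hWq]) (mul_nonneg (inv_pos.2 hLk0).le hvol0) r).trans (le_of_eq ?_)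
    ring
  · -- member `∂_μP∂*_ν`
    have hT := (h349D x x').2.2.2 μ ν
    rw [word_m4, hx, hx', hlev] at hT
    have hT' := (h349D' x x').2.2.2 μ ν
    rw [word_m4, hxD', hx'D', hWq', hlev'] at hT'
    have hTe : |Matrix.toLin' (dT (N0 ℓ Mh k P) μ * gmlT (N0 ℓ Mh k P) ℓ k D.lev a) (QsB D.toDomains (GinvT D a
        (QB D.toDomains (fun w => (dT (N0 ℓ Mh k P) ν * gmlT (N0 ℓ Mh k P) ℓ k D.lev a) x' w)))) x|
        ≤ B * (((ℓ : ℝ) + 1) ^ (1 * k) * ((ℓ : ℝ) + 1) ^ (1 * k) * (((ℓ : ℝ) + 1) ^ (4 * k))⁻¹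
            * (W D.toDomains ⟨q, hqD⟩)⁻¹) * Real.exp (-(ρ * (geomT D).dist ⟨p, hpD⟩ ⟨q, hqD⟩)) := by
      calc _ ≤ _ := hT
        _ = _ := by rw [s11]; ring
    have hTe' : |Matrix.toLin' (dT (N0 ℓ Mh k P) μ * gmlT (N0 ℓ Mh k P) ℓ k D'.lev a) (QsB D'.toDomains (GinvT D' a
        (QB D'.toDomains (fun w => (dT (N0 ℓ Mh k P) ν * gmlT (N0 ℓ Mh k P) ℓ k D'.lev a) x' w)))) x|
        ≤ B * (((ℓ : ℝ) + 1) ^ (1 * k) * ((ℓ : ℝ) + 1) ^ (1 * k) * (((ℓ : ℝ) + 1) ^ (4 * k))⁻¹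
            * (W D.toDomains ⟨q, hqD⟩)⁻¹) * Real.exp (-(ρ * (geomT D').dist ⟨p, hpD'⟩ ⟨q, hqD'⟩)) := by
      calc _ ≤ _ := hT'
        _ = _ := by rw [s11]; ring
    have r := p_engine D D' a hMh1 hP hRMone (nL := 1) (nR := 1) hC₀.le hC₁.le hCΔ0 hδpos hB.le hρ hy hy'
      (hE2 μ) (hE2' μ) (hF2 ν) (hF2' ν) hC hC' (hΔE2 μ) (hΔF2 ν) hΔC hthr2 hthrW h261D h261D' hTe hTe'
    rw [← hKt] at r
    rw [word_m4, word_m4]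
    refine (reshape hm0 hσ0.le (by rw [s11, hWq])
      (mul_nonneg (inv_pos.2 (pow_pos hLk0 2)).le hvol0) r).trans (le_of_eq ?_)
    ring

end Main

end

end Literature.MathematicalPhysics.QuantumFieldTheory.Balaban1983to89.B9Thm314PFlatMultiLevelTorus
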